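import Summits.QuantumFields.YangMills.Theorems.LuscherReductionTwistedTraceScalingBOCentralRatioRate
import Summits.QuantumFields.YangMills.Theorems.FlatTubeReductionCentralRatesThird
import Summits.QuantumFields.YangMills.Theorems.LuscherReductionTwistedTraceScalingBTRatesKappa
import HarnessLib

/-!
# (D3) ★★ THE RATE `hi₀/lo₀ ≤ 1 + β^{-1/3}` EVENTUALLY for the central transfer with the SHARP smearing window (crux K1 `NearFlatRatioLaw`, stub `stub_C1rate`)
# (explicit-unit seat `ym-line-ftr-p1` g19)

VERBATIM port of lane A's `…BOCentralRatioRate` (§1 `weighted_lo/hi`, §2 `central_ratio_rate`) to the weight `W₃ = β^{1/3}` (atoms `…_w3` of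
`…CentralRatesThird` and §0 here) and to the two-sided bound of `…CentralRecordThree.central_transfer_record_three` (slots `δu = β^{-1/2}ℓ³`,
`σ = β^{-1}`); the weight-generic §0 (`wt_congr`, `zt_congr`, `ratio_rate_of_weighted`) is reused.  Result `central_ratio_rate_w3`: for all real constants,
eventually `0 < lo₀(β)` and `hi₀(β) ≤ (1 + powScale (1/3) β)·lo₀(β)`.
§0 (the one NEW atom): the smearing transport exponent of the sharp window, `η₀'' = coreEta L β 0 δu T r_f Γ σ + coreEps1 + coreEps2(… σ)`, satisfies
`η₀'' ≤ (45L+1)⁴ℓ¹²β^{-1/2}(750|E| + 5140N₃ + 2193291N_P)` for `β ≥ 1` (`sharp_recordExponent_le`, twin of cdisprove R53R `repaired_recordExponent_le`, whose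
`δu = β^{-1/3}`, `σ = β^{-1/2}` version is only `O(ℓ⁸β^{-1/4})`), hence the weighted atom `zt_smearing_w3` (`p = 1/2 > 1/3`, `k = 12`).
HONEST FRAMING: rate bookkeeping toward stub_C1rate (OPEN); crux K1 OPEN; R2b1 is a RECORD rung; no summit statement is proved; the YM gap is NOT proved.
-/

open MeasureTheory Filter Topology Real
open scoped BigOperators RealInnerProductSpace
open Literature.MathematicalPhysics.QuantumFieldTheory
open Literature.MathematicalPhysics.QuantumLattice

namespace Summit.QuantumFields.YangMills.Theorems.FemtoTransferGap.TwoLattice.ConstTube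

open Summit.QuantumFields.YangMills.Theorems.FemtoTransferGap
open Summit.QuantumFields.YangMills.Theorems.FemtoTransferGap.TwoLattice
open Summit.QuantumFields.YangMills.Theorems.FemtoTransferGap.TwoLattice.Avg
open Summit.QuantumFields.YangMills.Theorems.FemtoTransferGap.TwoLattice.Stiff
open Summit.QuantumFields.YangMills.Theorems.FemtoTransferGap.TwoLattice.GnChart
open Summit.QuantumFields.YangMills.Theorems.TwistedTraceScaling.Negative

variable {L : ℕ} [NeZero L]

section Sharp

/-! ## §0 The SHARP smearing exponent (`δu = β^{-1/2}ℓ³`, `σ = β^{-1}`) is `O_L(ℓ¹²β^{-1/2})` -/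

omit [NeZero L] in
/-- The polynomial bookkeeping behind `sharp_recordExponent_le` (pure real algebra: every summand `≤ const·K⁴ℓ¹²x`). [folklore] -/
theorem sharp_exponent_poly_bound {β T d x y rf ℓ K E N P : ℝ} (hℓ : 1 ≤ ℓ) (hK : 1 ≤ K) (hE : 0 ≤ E) (hN : 0 ≤ N) (hP : 0 ≤ P)
    (hx0 : 0 ≤ x) (hx1 : x ≤ 1) (hy : y = x ^ 2) (hd : d = x * ℓ ^ 3) (hβ : 1 ≤ β)
    (hT0 : 0 ≤ T) (hT : T ≤ K * (x * ℓ ^ 2)) (hβT : β * T ^ 2 ≤ K ^ 2 * ℓ ^ 4) (hβrf : β * rf ^ 2 ≤ ℓ ^ 2) :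
    558 * E * (β * T ^ 2) * d ^ 2 + 192 * E * (β * T ^ 2) * d + 50 * N * y * (β * rf ^ 2) + 5040 * N * d * (β * rf ^ 2) + 50 * N * y * (β * rf ^ 2) +
        3456 * P * (β * T ^ 2) * x + 88128 * P * (β * T ^ 2) * T + 2101707 * P * (β * T ^ 2) * T ^ 2 ≤
      K ^ 4 * ℓ ^ 12 * x * (750 * E + 5140 * N + 2193291 * P) := by
  subst hy hd
  have hβ0 : 0 ≤ β := by linarith
  have hA0 : 0 ≤ β * T ^ 2 := by positivity
  have hB0 : 0 ≤ β * rf ^ 2 := by positivity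
  have hK0 : 0 ≤ K := by linarith
  have hℓ0 : 0 ≤ ℓ := by linarith
  have hx2 : x ^ 2 ≤ x := by nlinarith
  have hK2 : K ^ 2 ≤ K ^ 4 := pow_le_pow_right₀ hK (by norm_num)
  have hK3 : K ^ 3 ≤ K ^ 4 := pow_le_pow_right₀ hK (by norm_num)
  have hK4_1 : 1 ≤ K ^ 4 := one_le_pow₀ hK
  have hℓ2 : ℓ ^ 2 ≤ ℓ ^ 12 := pow_le_pow_right₀ hℓ (by norm_num)
  have hℓ4 : ℓ ^ 4 ≤ ℓ ^ 12 := pow_le_pow_right₀ hℓ (by norm_num)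
  have hℓ5 : ℓ ^ 5 ≤ ℓ ^ 12 := pow_le_pow_right₀ hℓ (by norm_num)
  have hℓ6 : ℓ ^ 6 ≤ ℓ ^ 12 := pow_le_pow_right₀ hℓ (by norm_num)
  have hℓ7 : ℓ ^ 7 ≤ ℓ ^ 12 := pow_le_pow_right₀ hℓ (by norm_num)
  have hℓ8 : ℓ ^ 8 ≤ ℓ ^ 12 := pow_le_pow_right₀ hℓ (by norm_num)
  have hℓ10 : ℓ ^ 10 ≤ ℓ ^ 12 := pow_le_pow_right₀ hℓ (by norm_num)
  have hK4_0 : 0 ≤ K ^ 4 := by positivity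
  have hU0 : 0 ≤ K ^ 4 * ℓ ^ 12 * x := by positivity
  -- unit bounds `K^a ℓ^b x ≤ K⁴ℓ¹²x`
  have unit : ∀ {a b : ℝ}, 0 ≤ a → a ≤ K ^ 4 → 0 ≤ b → b ≤ ℓ ^ 12 → a * b * x ≤ K ^ 4 * ℓ ^ 12 * x :=
    fun ha hale hb hble => mul_le_mul_of_nonneg_right (mul_le_mul hale hble hb hK4_0) hx0
  have u210 := unit (by positivity : (0:ℝ) ≤ K ^ 2) hK2 (by positivity : (0:ℝ) ≤ ℓ ^ 10) hℓ10
  have u27 := unit (by positivity : (0:ℝ) ≤ K ^ 2) hK2 (by positivity : (0:ℝ) ≤ ℓ ^ 7) hℓ7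
  have u02 := unit (zero_le_one) hK4_1 (by positivity : (0:ℝ) ≤ ℓ ^ 2) hℓ2
  have u05 := unit (zero_le_one) hK4_1 (by positivity : (0:ℝ) ≤ ℓ ^ 5) hℓ5
  have u24 := unit (by positivity : (0:ℝ) ≤ K ^ 2) hK2 (by positivity : (0:ℝ) ≤ ℓ ^ 4) hℓ4
  have u36 := unit (by positivity : (0:ℝ) ≤ K ^ 3) hK3 (by positivity : (0:ℝ) ≤ ℓ ^ 6) hℓ6
  have u48 := unit hK4_0 le_rfl (by positivity : (0:ℝ) ≤ ℓ ^ 8) hℓ8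
  -- the ten summands
  have t1 : (β * T ^ 2) * (x * ℓ ^ 3) ^ 2 ≤ K ^ 4 * ℓ ^ 12 * x := by
    calc (β * T ^ 2) * (x * ℓ ^ 3) ^ 2 = (β * T ^ 2) * ℓ ^ 6 * x ^ 2 := by ring
      _ ≤ (K ^ 2 * ℓ ^ 4) * ℓ ^ 6 * x := mul_le_mul (mul_le_mul_of_nonneg_right hβT (by positivity)) hx2 (by positivity) (by positivity)
      _ = K ^ 2 * ℓ ^ 10 * x := by ring
      _ ≤ _ := u210
  have t2 : (β * T ^ 2) * (x * ℓ ^ 3) ≤ K ^ 4 * ℓ ^ 12 * x := by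
    calc (β * T ^ 2) * (x * ℓ ^ 3) = (β * T ^ 2) * ℓ ^ 3 * x := by ring
      _ ≤ (K ^ 2 * ℓ ^ 4) * ℓ ^ 3 * x := mul_le_mul_of_nonneg_right (mul_le_mul_of_nonneg_right hβT (by positivity)) hx0
      _ = K ^ 2 * ℓ ^ 7 * x := by ring
      _ ≤ _ := u27
  have t3 : x ^ 2 * (β * rf ^ 2) ≤ K ^ 4 * ℓ ^ 12 * x := by
    calc x ^ 2 * (β * rf ^ 2) ≤ x * ℓ ^ 2 := mul_le_mul hx2 hβrf hB0 hx0
      _ = 1 * ℓ ^ 2 * x := by ring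
      _ ≤ _ := u02
  have t4 : (x * ℓ ^ 3) * (β * rf ^ 2) ≤ K ^ 4 * ℓ ^ 12 * x := by
    calc (x * ℓ ^ 3) * (β * rf ^ 2) ≤ (x * ℓ ^ 3) * ℓ ^ 2 := mul_le_mul_of_nonneg_left hβrf (by positivity)
      _ = 1 * ℓ ^ 5 * x := by ring
      _ ≤ _ := u05
  have t6 : (β * T ^ 2) * x ≤ K ^ 4 * ℓ ^ 12 * x := (mul_le_mul_of_nonneg_right hβT hx0).trans u24
  have hT1 : T ≤ K * ℓ ^ 2 * x := by calc T ≤ K * (x * ℓ ^ 2) := hT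
    _ = K * ℓ ^ 2 * x := by ring
  have t7 : (β * T ^ 2) * T ≤ K ^ 4 * ℓ ^ 12 * x := by
    calc (β * T ^ 2) * T ≤ (K ^ 2 * ℓ ^ 4) * (K * ℓ ^ 2 * x) := mul_le_mul hβT hT1 hT0 (by positivity)
      _ = K ^ 3 * ℓ ^ 6 * x := by ring
      _ ≤ _ := u36
  have hT2 : T ^ 2 ≤ K ^ 2 * ℓ ^ 4 * x := by
    calc T ^ 2 ≤ (K * (x * ℓ ^ 2)) ^ 2 := pow_le_pow_left₀ hT0 hT 2
      _ = K ^ 2 * ℓ ^ 4 * x ^ 2 := by ring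
      _ ≤ K ^ 2 * ℓ ^ 4 * x := mul_le_mul_of_nonneg_left hx2 (by positivity)
  have t8 : (β * T ^ 2) * T ^ 2 ≤ K ^ 4 * ℓ ^ 12 * x := by
    calc (β * T ^ 2) * T ^ 2 ≤ (K ^ 2 * ℓ ^ 4) * (K ^ 2 * ℓ ^ 4 * x) := mul_le_mul hβT hT2 (sq_nonneg _) (by positivity)
      _ = K ^ 4 * ℓ ^ 8 * x := by ring
      _ ≤ _ := u48
  linarith [mul_le_mul_of_nonneg_left t1 (by positivity : (0:ℝ) ≤ 558 * E), mul_le_mul_of_nonneg_left t2 (by positivity : (0:ℝ) ≤ 192 * E),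
    mul_le_mul_of_nonneg_left t3 (by positivity : (0:ℝ) ≤ 50 * N), mul_le_mul_of_nonneg_left t4 (by positivity : (0:ℝ) ≤ 5040 * N),
    mul_le_mul_of_nonneg_left t6 (by positivity : (0:ℝ) ≤ 3456 * P),
    mul_le_mul_of_nonneg_left t7 (by positivity : (0:ℝ) ≤ 88128 * P), mul_le_mul_of_nonneg_left t8 (by positivity : (0:ℝ) ≤ 2101707 * P)]

/-- ★★ **THE SHARP EXPONENT IS `O(ℓ¹²β^{-1/2})`**: with the smearing slots `δu := powScale (1/2) β·btLog β³`, `σ := powScale 1 β` (input window `T`, `r_f`, `Γ` as in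
the record), `η₀''(β) ≤ (45L+1)⁴·ℓ¹²·powScale (1/2) β·(750|E| + 5140N₃ + 2193291N_P)` for `β ≥ 1`. [cite: Luscher1983, §3] -/
theorem sharp_recordExponent_le {β : ℝ} (hβ : 1 ≤ β) :
    (coreEta L β 0 (powScale (1 / 2) β * btLog β ^ 3) (9 * (L : ℝ) * (5 * (powScale (1 / 2) β * btLog β ^ 2)) + (powScale 1 β)) (min (1 / 40) (powScale (1 / 2) β * btLog β)) ((powScale 1 β) * Fintype.card (Site 3 L)) (powScale 1 β) + coreEps1 L β 0 (9 * (L : ℝ) * (5 * (powScale (1 / 2) β * btLog β ^ 2)) + (powScale 1 β)) (min (1 / 40) (powScale (1 / 2) β * btLog β)) + coreEps2 L β 0 (9 * (L : ℝ) * (5 * (powScale (1 / 2) β * btLog β ^ 2)) + (powScale 1 β)) (min (1 / 40) (powScale (1 / 2) β * btLog β)) (powScale 1 β)) ≤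
      (45 * (L : ℝ) + 1) ^ 4 * btLog β ^ 12 * powScale (1 / 2) β *
        (750 * (Fintype.card (Edge 3 L) : ℝ) + 5140 * (Fintype.card (Plaquette 3 L × Fin 3) : ℝ) + 2193291 * (Fintype.card (Plaquette 3 L) : ℝ)) := by
  have hx0 : 0 < powScale (1 / 2) β := powScale_pos _ _
  have hx1 : powScale (1 / 2) β ≤ 1 := powScale_le_one (by norm_num) β
  have hy : powScale 1 β = powScale (1 / 2) β ^ 2 := by rw [R21.powScale_sq]; norm_num
  have hsx : Real.sqrt (powScale 1 β) = powScale (1 / 2) β := by rw [R50.sqrt_powScale]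
  have hβx : β * powScale (1 / 2) β ^ 2 = 1 := mul_powScale_half_sq hβ
  have hℓ : 1 ≤ btLog β := one_le_btLog β
  have hL : (1 : ℝ) ≤ (L : ℝ) := by exact_mod_cast Nat.one_le_iff_ne_zero.mpr (NeZero.ne L)
  have hK : (1 : ℝ) ≤ 45 * (L : ℝ) + 1 := by linarith
  have hT0 := R52.schedT_nonneg (L := L) β
  have hT := schedT_le (L := L) hβ
  have hβT := R52.beta_schedT_sq_le (L := L) hβ
  have hrf0 : 0 ≤ min (1 / 40) (powScale (1 / 2) β * btLog β) :=
    le_min (by norm_num) (mul_pos (powScale_pos _ _) (lt_of_lt_of_le one_pos hℓ)).le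
  have hβrf : β * min (1 / 40) (powScale (1 / 2) β * btLog β) ^ 2 ≤ btLog β ^ 2 := by
    have h1 : min (1 / 40) (powScale (1 / 2) β * btLog β) ^ 2 ≤ (powScale (1 / 2) β * btLog β) ^ 2 :=
      pow_le_pow_left₀ hrf0 (min_le_right _ _) 2
    calc β * min (1 / 40) (powScale (1 / 2) β * btLog β) ^ 2 ≤ β * (powScale (1 / 2) β * btLog β) ^ 2 :=
          mul_le_mul_of_nonneg_left h1 (by linarith)
      _ = (β * powScale (1 / 2) β ^ 2) * btLog β ^ 2 := by ring
      _ = btLog β ^ 2 := by rw [hβx, one_mul]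
  have hsN : Real.sqrt (Fintype.card (Plaquette 3 L × Fin 3) : ℝ) ^ 2 = (Fintype.card (Plaquette 3 L × Fin 3) : ℝ) :=
    Real.sq_sqrt (Nat.cast_nonneg _)
  have hform : (coreEta L β 0 (powScale (1 / 2) β * btLog β ^ 3) (9 * (L : ℝ) * (5 * (powScale (1 / 2) β * btLog β ^ 2)) + (powScale 1 β)) (min (1 / 40) (powScale (1 / 2) β * btLog β)) ((powScale 1 β) * Fintype.card (Site 3 L)) (powScale 1 β) + coreEps1 L β 0 (9 * (L : ℝ) * (5 * (powScale (1 / 2) β * btLog β ^ 2)) + (powScale 1 β)) (min (1 / 40) (powScale (1 / 2) β * btLog β)) + coreEps2 L β 0 (9 * (L : ℝ) * (5 * (powScale (1 / 2) β * btLog β ^ 2)) + (powScale 1 β)) (min (1 / 40) (powScale (1 / 2) β * btLog β)) (powScale 1 β)) = 558 * (Fintype.card (Edge 3 L) : ℝ) * (β * (9 * (L : ℝ) * (5 * (powScale (1 / 2) β * btLog β ^ 2)) + (powScale 1 β)) ^ 2) * (powScale (1 / 2) β * btLog β ^ 3) ^ 2 + 192 * (Fintype.card (Edge 3 L) : ℝ)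 * (β * (9 * (L : ℝ) * (5 * (powScale (1 / 2) β * btLog β ^ 2)) + (powScale 1 β)) ^ 2) * (powScale (1 / 2) β * btLog β ^ 3) + 50 * (Fintype.card (Plaquette 3 L × Fin 3) : ℝ) * powScale 1 β * (β * (min (1 / 40) (powScale (1 / 2) β * btLog β)) ^ 2) + 5040 * (Fintype.card (Plaquette 3 L × Fin 3) : ℝ) * (powScale (1 / 2) β * btLog β ^ 3) * (β * (min (1 / 40) (powScale (1 / 2) β * btLog β)) ^ 2) + 50 * Real.sqrt (Fintype.card (Plaquette 3 L × Fin 3) : ℝ) ^ 2 * powScale 1 β * (β * (min (1 / 40) (powScale (1 / 2) β * btLog β)) ^ 2) + 3456 * (Fintype.card (Plaquette 3 L) : ℝ) * (β * (9 * (L : ℝ) * (5 * (powScale (1 / 2) β * btLog β ^ 2)) + (powScale 1 β)) ^ 2) * powScale (1 / 2) β + 88128 * (Fintype.card (Plaquette 3 L) : ℝ) * (β * (9 * (L : ℝ) * (5 * (powScale (1 / 2) β * btLog β ^ 2)) + (powScale 1 β)) ^ 2) * (9 * (L : ℝ) * (5 * (powScale (1 / 2) β * btLog β ^ 2)) + (powScale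 1 β)) + 2101707 * (Fintype.card (Plaquette 3 L) : ℝ) * (β * (9 * (L : ℝ) * (5 * (powScale (1 / 2) β * btLog β ^ 2)) + (powScale 1 β)) ^ 2) * (9 * (L : ℝ) * (5 * (powScale (1 / 2) β * btLog β ^ 2)) + (powScale 1 β)) ^ 2 := by
    unfold coreEta coreEps1 coreEps2 Cov.stepActionErr
    rw [Real.sqrt_zero, hsx]
    ring
  rw [hform, hsN]
  have key := sharp_exponent_poly_bound (E := (Fintype.card (Edge 3 L) : ℝ)) (N := (Fintype.card (Plaquette 3 L × Fin 3) : ℝ))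
    (P := (Fintype.card (Plaquette 3 L) : ℝ)) (d := (powScale (1 / 2) β * btLog β ^ 3)) hℓ hK (Nat.cast_nonneg _) (Nat.cast_nonneg _) (Nat.cast_nonneg _) hx0.le hx1 hy rfl hβ hT0 hT hβT hβrf
  linarith [key]

/-- ★ Atom of the SHARP smearing window: the exponent `η₀''` has `η₀''·W₃ → 0` and `η₀'' → 0` (`W₃ = β^{1/3}`; `p = 1/2 > 1/3`, `k = 12`). [folklore] -/
theorem zt_smearing_w3 :
    Tendsto (fun β : ℝ => (coreEta L β 0 (powScale (1 / 2) β * btLog β ^ 3) (9 * (L : ℝ) * (5 * (powScale (1 / 2) β * btLog β ^ 2)) + (powScale 1 β)) (min (1 / 40) (powScale (1 / 2) β * btLog β)) ((powScale 1 β) * Fintype.card (Site 3 L)) (powScale 1 β) + coreEps1 L β 0 (9 * (L : ℝ) * (5 * (powScale (1 / 2) β * btLog β ^ 2)) + (powScale 1 β)) (min (1 / 40) (powScale (1 / 2) β * btLog β)) + coreEps2 L β 0 (9 * (L : ℝ) * (5 * (powScale (1 / 2) β * btLog β ^ 2)) + (powScale 1 β)) (min (1 / 40) (powScale (1 / 2)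 β * btLog β)) (powScale 1 β)) * powScale (-(1 / 3)) β) atTop (𝓝 0) ∧ Tendsto (fun β : ℝ => (coreEta L β 0 (powScale (1 / 2) β * btLog β ^ 3) (9 * (L : ℝ) * (5 * (powScale (1 / 2) β * btLog β ^ 2)) + (powScale 1 β)) (min (1 / 40) (powScale (1 / 2) β * btLog β)) ((powScale 1 β) * Fintype.card (Site 3 L)) (powScale 1 β) + coreEps1 L β 0 (9 * (L : ℝ) * (5 * (powScale (1 / 2) β * btLog β ^ 2)) + (powScale 1 β)) (min (1 / 40) (powScale (1 / 2) β * btLog β)) + coreEps2 L β 0 (9 * (L : ℝ) * (5 * (powScale (1 / 2) β * btLog β ^ 2)) + (powScale 1 β)) (min (1 / 40) (powScale (1 / 2) β * btLog β)) (powScale 1 β))) atTop (𝓝 0) := by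
  refine zt_atom_w3 (C := (45 * (L : ℝ) + 1) ^ 4 * (750 * (Fintype.card (Edge 3 L) : ℝ) + 5140 * (Fintype.card (Plaquette 3 L × Fin 3) : ℝ) + 2193291 * (Fintype.card (Plaquette 3 L) : ℝ)))
    (p := 1 / 2) (k := 12) (by norm_num) ?_
  filter_upwards [eventually_ge_atTop (1 : ℝ)] with β hβ
  have hβ0 : 0 ≤ β := by linarith
  have hℓ0 : 0 ≤ btLog β := le_trans zero_le_one (one_le_btLog β)
  have hT0 := R52.schedT_nonneg (L := L) β
  have hdu0 : 0 ≤ (powScale (1 / 2) β * btLog β ^ 3) := mul_nonneg (powScale_pos _ _).le (pow_nonneg hℓ0 3)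
  refine ⟨add_nonneg (add_nonneg (coreEta_nonneg (L := L) hβ0 le_rfl hdu0 hT0 (mul_nonneg (powScale_pos _ _).le (Nat.cast_nonneg _)) (powScale_pos _ _).le)
      (coreEps1_nonneg (L := L) hβ0 le_rfl hT0)) (coreEps2_nonneg (L := L) hβ0 hT0 (powScale_pos _ _).le), ?_⟩
  calc _ ≤ (45 * (L : ℝ) + 1) ^ 4 * btLog β ^ 12 * powScale (1 / 2) β *
        (750 * (Fintype.card (Edge 3 L) : ℝ) + 5140 * (Fintype.card (Plaquette 3 L × Fin 3) : ℝ) + 2193291 * (Fintype.card (Plaquette 3 L) : ℝ)) := sharp_recordExponent_le (L := L) hβ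
    _ = _ := by ring

end Sharp

/-! ## §1 The weighted deviations of `lo₀/N` and `hi₀/N` -/

set_option maxHeartbeats 1600000 in
-- the statement displays the ~4k-character lower bound of record verbatim; elaboration and the closing `ring` identity exceed the default budget.
/-- ★ `lo₀/N → 1` at rate `o(β^{-1/3})`: `(lo₀/N − 1)·β^{1/3} → 0` and `lo₀/N → 1` (repaired smearing window, schedule B). [folklore] -/
theorem weighted_lo_w3 (Ksp MT KD B CL Cp : ℝ) :
    Tendsto (fun β : ℝ => ((Real.exp (-(coreEta L β 0 (powScale (1 / 2) β * btLog β ^ 3) (9 * (L : ℝ) * (5 * (powScale (1 / 2) β * btLog β ^ 2)) + (powScale 1 β)) (min (1 / 40) (powScale (1 / 2) β * btLog β)) ((powScale 1 β) * Fintype.card (Site 3 L)) (powScale 1 β) + coreEps1 L β 0 (9 * (L : ℝ) * (5 * (powScale (1 / 2) β * btLog β ^ 2)) + (powScale 1 β)) (min (1 / 40) (powScale (1 / 2) β * btLog β)) + coreEps2 L β 0 (9 * (L : ℝ) * (5 * (powScale (1 / 2) β * btLog β ^ 2)) + (powScale 1 β)) (min (1 / 40) (powScale (1 / 2) β * btLog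 β)) (powScale 1 β))) *
          (1 * (Real.exp (2 * β) ^ Fintype.card (Edge 3 L) * ((2 * π ^ 2)⁻¹ * ((1 + (8 * (9 * (L : ℝ) * (5 * (powScale (1 / 2) β * btLog β ^ 2)) + (powScale 1 β))) ^ 2)⁻¹) ^ 2) ^ Fintype.card (Edge 3 L) *
              Real.exp (-(2000 * Fintype.card (Plaquette 3 L) * (8 * (9 * (L : ℝ) * (5 * (powScale (1 / 2) β * btLog β ^ 2)) + (powScale 1 β))) ^ 3 * β)) * (fpZ (powScale 1 β) * ((1:ℝ) * Real.exp (-(((96 * (β / 2) + (β)) * (B * (powScale 1 β * btLog β ^ 3) + MT * (powScale 1 β * btLog β ^ 3) ^ 2) * (2 * ((((min (1 / 40) (powScale (1 / 2) β * btLog β)) / 12) + (9 / 10 * (min (1 / 40) (powScale (1 / 2) β * btLog β)))) + 14 * ((Fintype.card (Edge 3 L) : ℝ)) * (8 * (9 * (L : ℝ) * (5 * (powScale (1 / 2) β * btLog β ^ 2)) + (powScale 1 β))) ^ 2 + (CL * ((4 + 48 * Ksp) * (8 * (9 * (L : ℝ) * (5 * (powScale (1 / 2) β * btLog β ^ 2))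 + (powScale 1 β)))) * (9 * Ksp * (8 * (9 * (L : ℝ) * (5 * (powScale (1 / 2) β * btLog β ^ 2)) + (powScale 1 β)))) + MT * (9 * Ksp * (8 * (9 * (L : ℝ) * (5 * (powScale (1 / 2) β * btLog β ^ 2)) + (powScale 1 β)))) ^ 2)) + (B * (powScale 1 β * btLog β ^ 3) + MT * (powScale 1 β * btLog β ^ 3) ^ 2))) + ((96 * (β / 2) + (β)) * ((CL * ((4 + 48 * Ksp) * (8 * (9 * (L : ℝ) * (5 * (powScale (1 / 2) β * btLog β ^ 2)) + (powScale 1 β)))) * (9 * Ksp * (8 * (9 * (L : ℝ) * (5 * (powScale (1 / 2) β * btLog β ^ 2)) + (powScale 1 β)))) + MT * (9 * Ksp * (8 * (9 * (L : ℝ) * (5 * (powScale (1 / 2) β * btLog β ^ 2)) + (powScale 1 β)))) ^ 2) * (2 * ((((min (1 / 40) (powScale (1 / 2) β * btLog β)) / 12) + (9 / 10 * (min (1 / 40) (powScale (1 / 2) β * btLog β)))) + 14 * ((Fintype.card (Edge 3 L) : ℝ)) * (8 * (9 * (L : ℝ) * (5 * (powScale (1 / 2) β * btLog β ^ 2)) +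 (powScale 1 β))) ^ 2 + (CL * ((4 + 48 * Ksp) * (8 * (9 * (L : ℝ) * (5 * (powScale (1 / 2) β * btLog β ^ 2)) + (powScale 1 β)))) * (9 * Ksp * (8 * (9 * (L : ℝ) * (5 * (powScale (1 / 2) β * btLog β ^ 2)) + (powScale 1 β)))) + MT * (9 * Ksp * (8 * (9 * (L : ℝ) * (5 * (powScale (1 / 2) β * btLog β ^ 2)) + (powScale 1 β)))) ^ 2)) + (CL * ((4 + 48 * Ksp) * (8 * (9 * (L : ℝ) * (5 * (powScale (1 / 2) β * btLog β ^ 2)) + (powScale 1 β)))) * (9 * Ksp * (8 * (9 * (L : ℝ) * (5 * (powScale (1 / 2) β * btLog β ^ 2)) + (powScale 1 β)))) + MT * (9 * Ksp * (8 * (9 * (L : ℝ) * (5 * (powScale (1 / 2) β * btLog β ^ 2)) + (powScale 1 β)))) ^ 2)) + 72 * ((Fintype.card (Edge 3 L) : ℝ)) * (8 * (9 * (L : ℝ) * (5 * (powScale (1 / 2) β * btLog β ^ 2)) + (powScale 1 β))) ^ 3)))) * ((fpWeightBar L (powScale 1 β) * (1 - Cp * (1 * powScale (1 / 4) β) ^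 2)) - ((1 + KD * ((4 + 48 * Ksp) * (8 * (9 * (L : ℝ) * (5 * (powScale (1 / 2) β * btLog β ^ 2)) + (powScale 1 β)))) ^ 2) * (4 : ℝ) ^ (flatDim L / 2 : ℝ) * Real.exp (-((1 / (4 * sliceConst L)) ^ 2 * (powScale 1 β * btLog β ^ 3) ^ 2 / (4 * (powScale 1 β) ^ 2))) * fpWeightBar L (powScale 1 β))))) *
            (Real.exp (-(882 * β * (9 * (L : ℝ) * (5 * (powScale (1 / 2) β * btLog β ^ 2)) + (powScale 1 β)) ^ 2 * ((min (1 / 40) (powScale (1 / 2) β * btLog β)) / 12) ^ 2)) -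
              Real.exp (49 * β * ((min (1 / 40) (powScale (1 / 2) β * btLog β)) / 12) ^ 2) * (Real.exp (-(β * (min ((8 * (9 * (L : ℝ) * (5 * (powScale (1 / 2) β * btLog β ^ 2)) + (powScale 1 β))) - 2 * (9 * (L : ℝ) * (5 * (powScale (1 / 2) β * btLog β ^ 2)) + (powScale 1 β))) ((9 / 10 * (min (1 / 40) (powScale (1 / 2) β * btLog β))) - 6 * (9 * (L : ℝ) * (5 * (powScale (1 / 2) β * btLog β ^ 2)) + (powScale 1 β)) ^ 2 * ((min (1 / 40) (powScale (1 / 2) β * btLog β)) / 12))) ^ 2 / 2)) * (π / (β / 2)) ^ ((Module.finrank ℝ (LinkSpace L) : ℝ) / 2)) /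
                stiffGaussTop L (β / 2) β)))) / (Real.exp (2 * β) ^ Fintype.card (Edge 3 L) * ((2 * π ^ 2)⁻¹) ^ Fintype.card (Edge 3 L) * fpZ (powScale 1 β) * fpWeightBar L (powScale 1 β)) - 1) * powScale (-(1 / 3)) β) atTop (𝓝 0) ∧
      Tendsto (fun β : ℝ => (Real.exp (-(coreEta L β 0 (powScale (1 / 2) β * btLog β ^ 3) (9 * (L : ℝ) * (5 * (powScale (1 / 2) β * btLog β ^ 2)) + (powScale 1 β)) (min (1 / 40) (powScale (1 / 2) β * btLog β)) ((powScale 1 β) * Fintype.card (Site 3 L)) (powScale 1 β) + coreEps1 L β 0 (9 * (L : ℝ) * (5 * (powScale (1 / 2) β * btLog β ^ 2)) + (powScale 1 β)) (min (1 / 40) (powScale (1 / 2) β * btLog β)) + coreEps2 L β 0 (9 * (L : ℝ) * (5 * (powScale (1 / 2) β * btLog β ^ 2)) + (powScale 1 β)) (min (1 / 40) (powScale (1 / 2) β * btLog β)) (powScale 1 β))) *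
          (1 * (Real.exp (2 * β) ^ Fintype.card (Edge 3 L) * ((2 * π ^ 2)⁻¹ * ((1 + (8 * (9 * (L : ℝ) * (5 * (powScale (1 / 2) β * btLog β ^ 2)) + (powScale 1 β))) ^ 2)⁻¹) ^ 2) ^ Fintype.card (Edge 3 L) *
              Real.exp (-(2000 * Fintype.card (Plaquette 3 L) * (8 * (9 * (L : ℝ) * (5 * (powScale (1 / 2) β * btLog β ^ 2)) + (powScale 1 β))) ^ 3 * β)) * (fpZ (powScale 1 β) * ((1:ℝ) * Real.exp (-(((96 * (β / 2) + (β)) * (B * (powScale 1 β * btLog β ^ 3) + MT * (powScale 1 β * btLog β ^ 3) ^ 2) * (2 * ((((min (1 / 40) (powScale (1 / 2) β * btLog β)) / 12) + (9 / 10 * (min (1 / 40) (powScale (1 / 2) β * btLog β)))) + 14 * ((Fintype.card (Edge 3 L) : ℝ)) * (8 * (9 * (L : ℝ) * (5 * (powScale (1 / 2) β * btLog β ^ 2)) + (powScale 1 β))) ^ 2 + (CL * ((4 + 48 * Ksp) * (8 * (9 * (L : ℝ) * (5 * (powScale (1 / 2) β * btLog β ^ 2)) + (powScale 1 β)))) *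 (9 * Ksp * (8 * (9 * (L : ℝ) * (5 * (powScale (1 / 2) β * btLog β ^ 2)) + (powScale 1 β)))) + MT * (9 * Ksp * (8 * (9 * (L : ℝ) * (5 * (powScale (1 / 2) β * btLog β ^ 2)) + (powScale 1 β)))) ^ 2)) + (B * (powScale 1 β * btLog β ^ 3) + MT * (powScale 1 β * btLog β ^ 3) ^ 2))) + ((96 * (β / 2) + (β)) * ((CL * ((4 + 48 * Ksp) * (8 * (9 * (L : ℝ) * (5 * (powScale (1 / 2) β * btLog β ^ 2)) + (powScale 1 β)))) * (9 * Ksp * (8 * (9 * (L : ℝ) * (5 * (powScale (1 / 2) β * btLog β ^ 2)) + (powScale 1 β)))) + MT * (9 * Ksp * (8 * (9 * (L : ℝ) * (5 * (powScale (1 / 2) β * btLog β ^ 2)) + (powScale 1 β)))) ^ 2) * (2 * ((((min (1 / 40) (powScale (1 / 2) β * btLog β)) / 12) + (9 / 10 * (min (1 / 40) (powScale (1 / 2) β * btLog β)))) + 14 * ((Fintype.card (Edge 3 L) : ℝ)) * (8 * (9 * (L : ℝ) * (5 * (powScale (1 / 2) β * btLog β ^ 2)) + (powScale 1 β))) ^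 2 + (CL * ((4 + 48 * Ksp) * (8 * (9 * (L : ℝ) * (5 * (powScale (1 / 2) β * btLog β ^ 2)) + (powScale 1 β)))) * (9 * Ksp * (8 * (9 * (L : ℝ) * (5 * (powScale (1 / 2) β * btLog β ^ 2)) + (powScale 1 β)))) + MT * (9 * Ksp * (8 * (9 * (L : ℝ) * (5 * (powScale (1 / 2) β * btLog β ^ 2)) + (powScale 1 β)))) ^ 2)) + (CL * ((4 + 48 * Ksp) * (8 * (9 * (L : ℝ) * (5 * (powScale (1 / 2) β * btLog β ^ 2)) + (powScale 1 β)))) * (9 * Ksp * (8 * (9 * (L : ℝ) * (5 * (powScale (1 / 2) β * btLog β ^ 2)) + (powScale 1 β)))) + MT * (9 * Ksp * (8 * (9 * (L : ℝ) * (5 * (powScale (1 / 2) β * btLog β ^ 2)) + (powScale 1 β)))) ^ 2)) + 72 * ((Fintype.card (Edge 3 L) : ℝ)) * (8 * (9 * (L : ℝ) * (5 * (powScale (1 / 2) β * btLog β ^ 2)) + (powScale 1 β))) ^ 3)))) * ((fpWeightBar L (powScale 1 β) * (1 - Cp * (1 * powScale (1 / 4) β) ^ 2)) - ((1 + KD *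 ((4 + 48 * Ksp) * (8 * (9 * (L : ℝ) * (5 * (powScale (1 / 2) β * btLog β ^ 2)) + (powScale 1 β)))) ^ 2) * (4 : ℝ) ^ (flatDim L / 2 : ℝ) * Real.exp (-((1 / (4 * sliceConst L)) ^ 2 * (powScale 1 β * btLog β ^ 3) ^ 2 / (4 * (powScale 1 β) ^ 2))) * fpWeightBar L (powScale 1 β))))) *
            (Real.exp (-(882 * β * (9 * (L : ℝ) * (5 * (powScale (1 / 2) β * btLog β ^ 2)) + (powScale 1 β)) ^ 2 * ((min (1 / 40) (powScale (1 / 2) β * btLog β)) / 12) ^ 2)) -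
              Real.exp (49 * β * ((min (1 / 40) (powScale (1 / 2) β * btLog β)) / 12) ^ 2) * (Real.exp (-(β * (min ((8 * (9 * (L : ℝ) * (5 * (powScale (1 / 2) β * btLog β ^ 2)) + (powScale 1 β))) - 2 * (9 * (L : ℝ) * (5 * (powScale (1 / 2) β * btLog β ^ 2)) + (powScale 1 β))) ((9 / 10 * (min (1 / 40) (powScale (1 / 2) β * btLog β))) - 6 * (9 * (L : ℝ) * (5 * (powScale (1 / 2) β * btLog β ^ 2)) + (powScale 1 β)) ^ 2 * ((min (1 / 40) (powScale (1 / 2) β * btLog β)) / 12))) ^ 2 / 2)) * (π / (β / 2)) ^ ((Module.finrank ℝ (LinkSpace L) : ℝ) / 2)) /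
                stiffGaussTop L (β / 2) β)))) / (Real.exp (2 * β) ^ Fintype.card (Edge 3 L) * ((2 * π ^ 2)⁻¹) ^ Fintype.card (Edge 3 L) * fpZ (powScale 1 β) * fpWeightBar L (powScale 1 β))) atTop (𝓝 1) := by
  have hNpos : ∀ β : ℝ, 0 < (Real.exp (2 * β) ^ Fintype.card (Edge 3 L) * ((2 * π ^ 2)⁻¹) ^ Fintype.card (Edge 3 L) * fpZ (powScale 1 β) * fpWeightBar L (powScale 1 β)) := fun β => by
    have := fpZ_pos (powScale_pos 1 β); have := fpWeightBar_pos (L := L) (powScale_pos 1 β); positivity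
  have hsplit : ∀ β : ℝ, ((2 * π ^ 2)⁻¹ * ((1 + (8 * (9 * (L : ℝ) * (5 * (powScale (1 / 2) β * btLog β ^ 2)) + powScale 1 β)) ^ 2)⁻¹) ^ 2) ^ Fintype.card (Edge 3 L) =
      ((2 * π ^ 2)⁻¹) ^ Fintype.card (Edge 3 L) * (((1 + (8 * (9 * (L : ℝ) * (5 * (powScale (1 / 2) β * btLog β ^ 2)) + powScale 1 β)) ^ 2)⁻¹) ^ 2) ^ Fintype.card (Edge 3 L) := fun β => mul_pow _ _ _
  have pX := zt_smearing_w3 (L := L)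
  have eXm := wt_exp_neg pX.1 pX.2
  have pcurv := wt_pow (wt_pow (wt_inv (wt_one_add (zt_rho_sq_w3 (L := L)))) 2) (Fintype.card (Edge 3 L))
  have hG : Tendsto (fun β : ℝ => 2000 * Fintype.card (Plaquette 3 L) * (8 * (9 * (L : ℝ) * (5 * (powScale (1 / 2) β * btLog β ^ 2)) + powScale 1 β)) ^ 3 * β * powScale (-(1 / 3)) β) atTop (𝓝 0) ∧
      Tendsto (fun β : ℝ => 2000 * Fintype.card (Plaquette 3 L) * (8 * (9 * (L : ℝ) * (5 * (powScale (1 / 2) β * btLog β ^ 2)) + powScale 1 β)) ^ 3 * β) atTop (𝓝 0) := by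
    have h := zt_const_mul (2000 * (Fintype.card (Plaquette 3 L) : ℝ)) (zt_beta_rho_cube_w3 (L := L))
    exact ⟨h.1.congr' (Eventually.of_forall fun β => by ring), h.2.congr' (Eventually.of_forall fun β => by ring)⟩
  have tGm := wt_exp_neg hG.1 hG.2
  have eDm := wt_exp_neg (zt_transport_defects_w3 (L := L) Ksp MT B CL).1 (tendsto_transport_defects (L := L) Ksp MT B CL).1
  have tdm := wt_one_sub (zt_defect_w3 Cp)
  have tTb := zt_sliceTail_w3 (L := L) KD Ksp
  have hloc := zt_loc_w3 (L := L)
  have tE1m := wt_exp_neg hloc.1 hloc.2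
  have tTail := zt_gaussTail_w3 (L := L)
  have pflo := wt_mul (wt_mul (wt_mul (wt_mul (wt_mul eXm pcurv) tGm) eDm) (wt_sub_tail tdm tTb)) (wt_sub_tail tE1m tTail)
  refine wt_congr pflo ?_
  filter_upwards [eventually_ge_atTop (1 : ℝ)] with β hβ
  rw [eq_div_iff (hNpos β).ne', hsplit β]
  ring

set_option maxHeartbeats 1600000 in
-- the statement displays the ~4k-character upper bound of record verbatim; elaboration and the closing `ring` identity exceed the default budget.
/-- ★ `hi₀/N → 1` at rate `o(β^{-1/3})`: `(hi₀/N − 1)·β^{1/3} → 0` and `hi₀/N → 1` (repaired smearing window, schedule B). [folklore] -/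
theorem weighted_hi_w3 (Ksp MT KD B CL Cp : ℝ) :
    Tendsto (fun β : ℝ => ((Real.exp (coreEta L β 0 (powScale (1 / 2) β * btLog β ^ 3) (9 * (L : ℝ) * (5 * (powScale (1 / 2) β * btLog β ^ 2)) + (powScale 1 β)) (min (1 / 40) (powScale (1 / 2) β * btLog β)) ((powScale 1 β) * Fintype.card (Site 3 L)) (powScale 1 β) + coreEps1 L β 0 (9 * (L : ℝ) * (5 * (powScale (1 / 2) β * btLog β ^ 2)) + (powScale 1 β)) (min (1 / 40) (powScale (1 / 2) β * btLog β)) + coreEps2 L β 0 (9 * (L : ℝ) * (5 * (powScale (1 / 2) β * btLog β ^ 2)) + (powScale 1 β)) (min (1 / 40) (powScale (1 / 2) β * btLog β)) (powScale 1 β)) *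
          (1 * (Real.exp (2 * β) ^ Fintype.card (Edge 3 L) * ((2 * π ^ 2)⁻¹) ^ Fintype.card (Edge 3 L) * Real.exp (2000 * Fintype.card (Plaquette 3 L) * (8 * (9 * (L : ℝ) * (5 * (powScale (1 / 2) β * btLog β ^ 2)) + (powScale 1 β))) ^ 3 * β) *
                Real.exp (8 * Fintype.card (Edge 3 L) * β * (8 * (9 * (L : ℝ) * (5 * (powScale (1 / 2) β * btLog β ^ 2)) + (powScale 1 β))) ^ 4) * (fpZ (powScale 1 β) * (1:ℝ) * (Real.exp (((96 * (β / 2) + (β)) * (B * (powScale 1 β * btLog β ^ 3) + MT * (powScale 1 β * btLog β ^ 3) ^ 2) * (2 * (Real.sqrt ((Fintype.card (Edge 3 L) : ℝ)) * (8 * (9 * (L : ℝ) * (5 * (powScale (1 / 2) β * btLog β ^ 2)) + (powScale 1 β))) + (7 * ((Fintype.card (Edge 3 L) : ℝ)) * (8 * (9 * (L : ℝ) * (5 * (powScale (1 / 2) β * btLog β ^ 2)) + (powScale 1 β))) + B * (9 * Ksp * (8 * (9 * (L : ℝ) * (5 * (powScale (1 / 2) β * btLog β ^ 2)) + (powScale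 1 β)))) + MT * (9 * Ksp * (8 * (9 * (L : ℝ) * (5 * (powScale (1 / 2) β * btLog β ^ 2)) + (powScale 1 β)))) ^ 2)) + (B * (powScale 1 β * btLog β ^ 3) + MT * (powScale 1 β * btLog β ^ 3) ^ 2))) + ((96 * (β / 2) + (β)) * ((CL * ((4 + 48 * Ksp) * (8 * (9 * (L : ℝ) * (5 * (powScale (1 / 2) β * btLog β ^ 2)) + (powScale 1 β)))) * (9 * Ksp * (8 * (9 * (L : ℝ) * (5 * (powScale (1 / 2) β * btLog β ^ 2)) + (powScale 1 β)))) + MT * (9 * Ksp * (8 * (9 * (L : ℝ) * (5 * (powScale (1 / 2) β * btLog β ^ 2)) + (powScale 1 β)))) ^ 2) * (2 * (Real.sqrt ((Fintype.card (Edge 3 L) : ℝ)) * (8 * (9 * (L : ℝ) * (5 * (powScale (1 / 2) β * btLog β ^ 2)) + (powScale 1 β))) + (7 * ((Fintype.card (Edge 3 L) : ℝ)) * (8 * (9 * (L : ℝ) * (5 * (powScale (1 / 2) β * btLog β ^ 2)) + (powScale 1 β))) + B * (9 * Ksp * (8 * (9 * (L : ℝ) * (5 * (powScale (1 / 2) β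 * btLog β ^ 2)) + (powScale 1 β)))) + MT * (9 * Ksp * (8 * (9 * (L : ℝ) * (5 * (powScale (1 / 2) β * btLog β ^ 2)) + (powScale 1 β)))) ^ 2)) + (CL * ((4 + 48 * Ksp) * (8 * (9 * (L : ℝ) * (5 * (powScale (1 / 2) β * btLog β ^ 2)) + (powScale 1 β)))) * (9 * Ksp * (8 * (9 * (L : ℝ) * (5 * (powScale (1 / 2) β * btLog β ^ 2)) + (powScale 1 β)))) + MT * (9 * Ksp * (8 * (9 * (L : ℝ) * (5 * (powScale (1 / 2) β * btLog β ^ 2)) + (powScale 1 β)))) ^ 2)) + 72 * ((Fintype.card (Edge 3 L) : ℝ)) * (8 * (9 * (L : ℝ) * (5 * (powScale (1 / 2) β * btLog β ^ 2)) + (powScale 1 β))) ^ 3))) * (fpWeightBar L (powScale 1 β) * (1 + Cp * (1 * powScale (1 / 4) β) ^ 2)) + ((1 + KD * ((4 + 48 * Ksp) * (8 * (9 * (L : ℝ) * (5 * (powScale (1 / 2) β * btLog β ^ 2)) + (powScale 1 β)))) ^ 2) * (4 : ℝ) ^ (flatDim L / 2 : ℝ) * Real.exp (-((1 / (4 * sliceConst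 L)) ^ 2 * (powScale 1 β * btLog β ^ 3) ^ 2 / (4 * (powScale 1 β) ^ 2))) * fpWeightBar L (powScale 1 β)) * Real.exp ((96 * (β / 2) + (β)) * (Real.sqrt ((Fintype.card (Edge 3 L) : ℝ)) * (8 * (9 * (L : ℝ) * (5 * (powScale (1 / 2) β * btLog β ^ 2)) + (powScale 1 β)))) ^ 2))) * Real.exp (882 * β * (9 * (L : ℝ) * (5 * (powScale (1 / 2) β * btLog β ^ 2)) + (powScale 1 β)) ^ 2 * ((min (1 / 40) (powScale (1 / 2) β * btLog β)) / 12) ^ 2) +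
              (1:ℝ) * (1:ℝ) * 1 * (Real.exp (2 * β) ^ Fintype.card (Edge 3 L) * Real.exp (-(β * (8 * (9 * (L : ℝ) * (5 * (powScale (1 / 2) β * btLog β ^ 2)) + (powScale 1 β))) ^ 2 / 4))) * Real.exp (49 * β * ((min (1 / 40) (powScale (1 / 2) β * btLog β)) / 12) ^ 2) / stiffGaussTop L (β / 2) β))) / (Real.exp (2 * β) ^ Fintype.card (Edge 3 L) * ((2 * π ^ 2)⁻¹) ^ Fintype.card (Edge 3 L) * fpZ (powScale 1 β) * fpWeightBar L (powScale 1 β)) - 1) * powScale (-(1 / 3)) β) atTop (𝓝 0) ∧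
      Tendsto (fun β : ℝ => (Real.exp (coreEta L β 0 (powScale (1 / 2) β * btLog β ^ 3) (9 * (L : ℝ) * (5 * (powScale (1 / 2) β * btLog β ^ 2)) + (powScale 1 β)) (min (1 / 40) (powScale (1 / 2) β * btLog β)) ((powScale 1 β) * Fintype.card (Site 3 L)) (powScale 1 β) + coreEps1 L β 0 (9 * (L : ℝ) * (5 * (powScale (1 / 2) β * btLog β ^ 2)) + (powScale 1 β)) (min (1 / 40) (powScale (1 / 2) β * btLog β)) + coreEps2 L β 0 (9 * (L : ℝ) * (5 * (powScale (1 / 2) β * btLog β ^ 2)) + (powScale 1 β)) (min (1 / 40) (powScale (1 / 2) β * btLog β)) (powScale 1 β)) *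
          (1 * (Real.exp (2 * β) ^ Fintype.card (Edge 3 L) * ((2 * π ^ 2)⁻¹) ^ Fintype.card (Edge 3 L) * Real.exp (2000 * Fintype.card (Plaquette 3 L) * (8 * (9 * (L : ℝ) * (5 * (powScale (1 / 2) β * btLog β ^ 2)) + (powScale 1 β))) ^ 3 * β) *
                Real.exp (8 * Fintype.card (Edge 3 L) * β * (8 * (9 * (L : ℝ) * (5 * (powScale (1 / 2) β * btLog β ^ 2)) + (powScale 1 β))) ^ 4) * (fpZ (powScale 1 β) * (1:ℝ) * (Real.exp (((96 * (β / 2) + (β)) * (B * (powScale 1 β * btLog β ^ 3) + MT * (powScale 1 β * btLog β ^ 3) ^ 2) * (2 * (Real.sqrt ((Fintype.card (Edge 3 L) : ℝ)) * (8 * (9 * (L : ℝ) * (5 * (powScale (1 / 2) β * btLog β ^ 2)) + (powScale 1 β))) + (7 * ((Fintype.card (Edge 3 L) : ℝ)) * (8 * (9 * (L : ℝ) * (5 * (powScale (1 / 2) β * btLog β ^ 2)) + (powScale 1 β))) + B * (9 * Ksp * (8 * (9 * (L : ℝ) * (5 * (powScale (1 / 2) β * btLog β ^ 2)) + (powScale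 1 β)))) + MT * (9 * Ksp * (8 * (9 * (L : ℝ) * (5 * (powScale (1 / 2) β * btLog β ^ 2)) + (powScale 1 β)))) ^ 2)) + (B * (powScale 1 β * btLog β ^ 3) + MT * (powScale 1 β * btLog β ^ 3) ^ 2))) + ((96 * (β / 2) + (β)) * ((CL * ((4 + 48 * Ksp) * (8 * (9 * (L : ℝ) * (5 * (powScale (1 / 2) β * btLog β ^ 2)) + (powScale 1 β)))) * (9 * Ksp * (8 * (9 * (L : ℝ) * (5 * (powScale (1 / 2) β * btLog β ^ 2)) + (powScale 1 β)))) + MT * (9 * Ksp * (8 * (9 * (L : ℝ) * (5 * (powScale (1 / 2) β * btLog β ^ 2)) + (powScale 1 β)))) ^ 2) * (2 * (Real.sqrt ((Fintype.card (Edge 3 L) : ℝ)) * (8 * (9 * (L : ℝ) * (5 * (powScale (1 / 2) β * btLog β ^ 2)) + (powScale 1 β))) + (7 * ((Fintype.card (Edge 3 L) : ℝ)) * (8 * (9 * (L : ℝ) * (5 * (powScale (1 / 2) β * btLog β ^ 2)) + (powScale 1 β))) + B * (9 * Ksp * (8 * (9 * (L : ℝ) * (5 * (powScale (1 / 2) β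 * btLog β ^ 2)) + (powScale 1 β)))) + MT * (9 * Ksp * (8 * (9 * (L : ℝ) * (5 * (powScale (1 / 2) β * btLog β ^ 2)) + (powScale 1 β)))) ^ 2)) + (CL * ((4 + 48 * Ksp) * (8 * (9 * (L : ℝ) * (5 * (powScale (1 / 2) β * btLog β ^ 2)) + (powScale 1 β)))) * (9 * Ksp * (8 * (9 * (L : ℝ) * (5 * (powScale (1 / 2) β * btLog β ^ 2)) + (powScale 1 β)))) + MT * (9 * Ksp * (8 * (9 * (L : ℝ) * (5 * (powScale (1 / 2) β * btLog β ^ 2)) + (powScale 1 β)))) ^ 2)) + 72 * ((Fintype.card (Edge 3 L) : ℝ)) * (8 * (9 * (L : ℝ) * (5 * (powScale (1 / 2) β * btLog β ^ 2)) + (powScale 1 β))) ^ 3))) * (fpWeightBar L (powScale 1 β) * (1 + Cp * (1 * powScale (1 / 4) β) ^ 2)) + ((1 + KD * ((4 + 48 * Ksp) * (8 * (9 * (L : ℝ) * (5 * (powScale (1 / 2) β * btLog β ^ 2)) + (powScale 1 β)))) ^ 2) * (4 : ℝ) ^ (flatDim L / 2 : ℝ) * Real.exp (-((1 / (4 * sliceConst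 L)) ^ 2 * (powScale 1 β * btLog β ^ 3) ^ 2 / (4 * (powScale 1 β) ^ 2))) * fpWeightBar L (powScale 1 β)) * Real.exp ((96 * (β / 2) + (β)) * (Real.sqrt ((Fintype.card (Edge 3 L) : ℝ)) * (8 * (9 * (L : ℝ) * (5 * (powScale (1 / 2) β * btLog β ^ 2)) + (powScale 1 β)))) ^ 2))) * Real.exp (882 * β * (9 * (L : ℝ) * (5 * (powScale (1 / 2) β * btLog β ^ 2)) + (powScale 1 β)) ^ 2 * ((min (1 / 40) (powScale (1 / 2) β * btLog β)) / 12) ^ 2) +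
              (1:ℝ) * (1:ℝ) * 1 * (Real.exp (2 * β) ^ Fintype.card (Edge 3 L) * Real.exp (-(β * (8 * (9 * (L : ℝ) * (5 * (powScale (1 / 2) β * btLog β ^ 2)) + (powScale 1 β))) ^ 2 / 4))) * Real.exp (49 * β * ((min (1 / 40) (powScale (1 / 2) β * btLog β)) / 12) ^ 2) / stiffGaussTop L (β / 2) β))) / (Real.exp (2 * β) ^ Fintype.card (Edge 3 L) * ((2 * π ^ 2)⁻¹) ^ Fintype.card (Edge 3 L) * fpZ (powScale 1 β) * fpWeightBar L (powScale 1 β))) atTop (𝓝 1) := by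
  have hNpos : ∀ β : ℝ, 0 < (Real.exp (2 * β) ^ Fintype.card (Edge 3 L) * ((2 * π ^ 2)⁻¹) ^ Fintype.card (Edge 3 L) * fpZ (powScale 1 β) * fpWeightBar L (powScale 1 β)) := fun β => by
    have := fpZ_pos (powScale_pos 1 β); have := fpWeightBar_pos (L := L) (powScale_pos 1 β); positivity
  have pX := zt_smearing_w3 (L := L)
  have eXp := wt_exp pX.1 pX.2
  have hG : Tendsto (fun β : ℝ => 2000 * Fintype.card (Plaquette 3 L) * (8 * (9 * (L : ℝ) * (5 * (powScale (1 / 2) β * btLog β ^ 2)) + powScale 1 β)) ^ 3 * β * powScale (-(1 / 3)) β) atTop (𝓝 0) ∧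
      Tendsto (fun β : ℝ => 2000 * Fintype.card (Plaquette 3 L) * (8 * (9 * (L : ℝ) * (5 * (powScale (1 / 2) β * btLog β ^ 2)) + powScale 1 β)) ^ 3 * β) atTop (𝓝 0) := by
    have h := zt_const_mul (2000 * (Fintype.card (Plaquette 3 L) : ℝ)) (zt_beta_rho_cube_w3 (L := L))
    exact ⟨h.1.congr' (Eventually.of_forall fun β => by ring), h.2.congr' (Eventually.of_forall fun β => by ring)⟩
  have tGp := wt_exp hG.1 hG.2
  have hG4 : Tendsto (fun β : ℝ => 8 * Fintype.card (Edge 3 L) * β * (8 * (9 * (L : ℝ) * (5 * (powScale (1 / 2) β * btLog β ^ 2)) + powScale 1 β)) ^ 4 * powScale (-(1 / 3)) β) atTop (𝓝 0) ∧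
      Tendsto (fun β : ℝ => 8 * Fintype.card (Edge 3 L) * β * (8 * (9 * (L : ℝ) * (5 * (powScale (1 / 2) β * btLog β ^ 2)) + powScale 1 β)) ^ 4) atTop (𝓝 0) := by
    have h := zt_const_mul (8 * (Fintype.card (Edge 3 L) : ℝ)) (zt_beta_rho_four_w3 (L := L))
    exact ⟨h.1.congr' (Eventually.of_forall fun β => by ring), h.2.congr' (Eventually.of_forall fun β => by ring)⟩
  have tG4 := wt_exp hG4.1 hG4.2
  have eDp := wt_exp (zt_transport_defects_w3 (L := L) Ksp MT B CL).2 (tendsto_transport_defects (L := L) Ksp MT B CL).2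
  have tdp := wt_one_add (zt_defect_w3 Cp)
  have tTbG := zt_sliceTail_mul_gaussLoss_w3 (L := L) KD Ksp
  have hloc := zt_loc_w3 (L := L)
  have tE1p := wt_exp hloc.1 hloc.2
  have tFar := zt_farTail_w3 (L := L)
  have pghi := wt_add_tail (wt_mul (wt_mul (wt_mul (wt_mul eXp tGp) tG4) (wt_add_tail (wt_mul eDp tdp) tTbG)) tE1p) (zt_mul eXp tFar)
  refine wt_congr pghi ?_
  filter_upwards [eventually_ge_atTop (1 : ℝ)] with β hβ
  have hZ := fpZ_pos (powScale_pos 1 β)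
  have hW := fpWeightBar_pos (L := L) (powScale_pos 1 β)
  obtain ⟨hSlo, -⟩ := stiffGaussTop_record_bounds (L := L) (show (0 : ℝ) < β by linarith)
  have hS : 0 < stiffGaussTop L (β / 2) β := lt_of_lt_of_le (pow_pos (Real.sqrt_pos.2 (by positivity)) _) hSlo
  have hQ : (0 : ℝ) < ((2 * π ^ 2)⁻¹) ^ Fintype.card (Edge 3 L) := by positivity
  have hfar : Real.exp (-(β * (8 * (9 * (L : ℝ) * (5 * (powScale (1 / 2) β * btLog β ^ 2)) + powScale 1 β)) ^ 2 / 4)) * Real.exp (49 * β * ((min (1 / 40) (powScale (1 / 2) β * btLog β)) / 12) ^ 2) / stiffGaussTop L (β / 2) β / (((2 * π ^ 2)⁻¹) ^ Fintype.card (Edge 3 L) * fpZ (powScale 1 β) * fpWeightBar L (powScale 1 β)) * (Real.exp (2 * β) ^ Fintype.card (Edge 3 L) * ((2 * π ^ 2)⁻¹) ^ Fintype.card (Edge 3 L) * fpZ (powScale 1 β) * fpWeightBar L (powScale 1 β)) =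
        Real.exp (2 * β) ^ Fintype.card (Edge 3 L) * Real.exp (-(β * (8 * (9 * (L : ℝ) * (5 * (powScale (1 / 2) β * btLog β ^ 2)) + powScale 1 β)) ^ 2 / 4)) * Real.exp (49 * β * ((min (1 / 40) (powScale (1 / 2) β * btLog β)) / 12) ^ 2) / stiffGaussTop L (β / 2) β := by
    field_simp
  rw [eq_div_iff (hNpos β).ne', add_mul, mul_assoc (Real.exp (coreEta L β 0 (powScale (1 / 2) β * btLog β ^ 3) (9 * (L : ℝ) * (5 * (powScale (1 / 2) β * btLog β ^ 2)) + (powScale 1 β)) (min (1 / 40) (powScale (1 / 2) β * btLog β)) ((powScale 1 β) * Fintype.card (Site 3 L)) (powScale 1 β) + coreEps1 L β 0 (9 * (L : ℝ) * (5 * (powScale (1 / 2) β * btLog β ^ 2)) + (powScale 1 β)) (min (1 / 40) (powScale (1 / 2) β * btLog β)) + coreEps2 L β 0 (9 * (L : ℝ) * (5 * (powScale (1 / 2) β * btLog β ^ 2)) + (powScale 1 β)) (min (1 / 40) (powScale (1 / 2) β * btLog β)) (powScale 1 β))) (Real.exp (-(β * (8 * (9 * (L : ℝ) * (5 * (powScale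 (1 / 2) β * btLog β ^ 2)) + powScale 1 β)) ^ 2 / 4)) * Real.exp (49 * β * ((min (1 / 40) (powScale (1 / 2) β * btLog β)) / 12) ^ 2) / stiffGaussTop L (β / 2) β / (((2 * π ^ 2)⁻¹) ^ Fintype.card (Edge 3 L) * fpZ (powScale 1 β) * fpWeightBar L (powScale 1 β))) (Real.exp (2 * β) ^ Fintype.card (Edge 3 L) * ((2 * π ^ 2)⁻¹) ^ Fintype.card (Edge 3 L) * fpZ (powScale 1 β) * fpWeightBar L (powScale 1 β)), hfar]
  ring

/-! ## §2 ★★ The rate -/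

set_option maxHeartbeats 800000 in
-- the statement displays the two ~4k-character bounds of record verbatim.
/-- ★★ **THE RATE `hi₀ ≤ (1 + β^{-1/3})·lo₀` for the two-sided central transfer bound of record (repaired smearing window).**
For all real constants: eventually `0 < lo₀(β)` and `hi₀(β) ≤ (1 + powScale (1/3) β)·lo₀(β)`. [folklore] -/
theorem central_ratio_rate_w3 (Ksp MT KD B CL Cp : ℝ) :
    ∀ᶠ β : ℝ in atTop,
      0 < Real.exp (-(coreEta L β 0 (powScale (1 / 2) β * btLog β ^ 3) (9 * (L : ℝ) * (5 * (powScale (1 / 2) β * btLog β ^ 2)) + (powScale 1 β)) (min (1 / 40) (powScale (1 / 2) β * btLog β)) ((powScale 1 β) * Fintype.card (Site 3 L)) (powScale 1 β) + coreEps1 L β 0 (9 * (L : ℝ) * (5 * (powScale (1 / 2) β * btLog β ^ 2)) + (powScale 1 β)) (min (1 / 40) (powScale (1 / 2) β * btLog β)) + coreEps2 L β 0 (9 * (L : ℝ) * (5 * (powScale (1 / 2) β * btLog β ^ 2)) + (powScale 1 β)) (min (1 / 40) (powScale (1 / 2) β * btLog β)) (powScale 1 β))) *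
          (1 * (Real.exp (2 * β) ^ Fintype.card (Edge 3 L) * ((2 * π ^ 2)⁻¹ * ((1 + (8 * (9 * (L : ℝ) * (5 * (powScale (1 / 2) β * btLog β ^ 2)) + (powScale 1 β))) ^ 2)⁻¹) ^ 2) ^ Fintype.card (Edge 3 L) *
              Real.exp (-(2000 * Fintype.card (Plaquette 3 L) * (8 * (9 * (L : ℝ) * (5 * (powScale (1 / 2) β * btLog β ^ 2)) + (powScale 1 β))) ^ 3 * β)) * (fpZ (powScale 1 β) * ((1:ℝ) * Real.exp (-(((96 * (β / 2) + (β)) * (B * (powScale 1 β * btLog β ^ 3) + MT * (powScale 1 β * btLog β ^ 3) ^ 2) * (2 * ((((min (1 / 40) (powScale (1 / 2) β * btLog β)) / 12) + (9 / 10 * (min (1 / 40) (powScale (1 / 2) β * btLog β)))) + 14 * ((Fintype.card (Edge 3 L) : ℝ)) * (8 * (9 * (L : ℝ) * (5 * (powScale (1 / 2) β * btLog β ^ 2)) + (powScale 1 β))) ^ 2 + (CL * ((4 + 48 * Ksp) * (8 * (9 * (L : ℝ) * (5 * (powScale (1 / 2) β * btLog β ^ 2)) + (powScale 1 β)))) *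 (9 * Ksp * (8 * (9 * (L : ℝ) * (5 * (powScale (1 / 2) β * btLog β ^ 2)) + (powScale 1 β)))) + MT * (9 * Ksp * (8 * (9 * (L : ℝ) * (5 * (powScale (1 / 2) β * btLog β ^ 2)) + (powScale 1 β)))) ^ 2)) + (B * (powScale 1 β * btLog β ^ 3) + MT * (powScale 1 β * btLog β ^ 3) ^ 2))) + ((96 * (β / 2) + (β)) * ((CL * ((4 + 48 * Ksp) * (8 * (9 * (L : ℝ) * (5 * (powScale (1 / 2) β * btLog β ^ 2)) + (powScale 1 β)))) * (9 * Ksp * (8 * (9 * (L : ℝ) * (5 * (powScale (1 / 2) β * btLog β ^ 2)) + (powScale 1 β)))) + MT * (9 * Ksp * (8 * (9 * (L : ℝ) * (5 * (powScale (1 / 2) β * btLog β ^ 2)) + (powScale 1 β)))) ^ 2) * (2 * ((((min (1 / 40) (powScale (1 / 2) β * btLog β)) / 12) + (9 / 10 * (min (1 / 40) (powScale (1 / 2) β * btLog β)))) + 14 * ((Fintype.card (Edge 3 L) : ℝ)) * (8 * (9 * (L : ℝ) * (5 * (powScale (1 / 2) β * btLog β ^ 2)) + (powScale 1 β))) ^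 2 + (CL * ((4 + 48 * Ksp) * (8 * (9 * (L : ℝ) * (5 * (powScale (1 / 2) β * btLog β ^ 2)) + (powScale 1 β)))) * (9 * Ksp * (8 * (9 * (L : ℝ) * (5 * (powScale (1 / 2) β * btLog β ^ 2)) + (powScale 1 β)))) + MT * (9 * Ksp * (8 * (9 * (L : ℝ) * (5 * (powScale (1 / 2) β * btLog β ^ 2)) + (powScale 1 β)))) ^ 2)) + (CL * ((4 + 48 * Ksp) * (8 * (9 * (L : ℝ) * (5 * (powScale (1 / 2) β * btLog β ^ 2)) + (powScale 1 β)))) * (9 * Ksp * (8 * (9 * (L : ℝ) * (5 * (powScale (1 / 2) β * btLog β ^ 2)) + (powScale 1 β)))) + MT * (9 * Ksp * (8 * (9 * (L : ℝ) * (5 * (powScale (1 / 2) β * btLog β ^ 2)) + (powScale 1 β)))) ^ 2)) + 72 * ((Fintype.card (Edge 3 L) : ℝ)) * (8 * (9 * (L : ℝ) * (5 * (powScale (1 / 2) β * btLog β ^ 2)) + (powScale 1 β))) ^ 3)))) * ((fpWeightBar L (powScale 1 β) * (1 - Cp * (1 * powScale (1 / 4) β) ^ 2)) - ((1 + KD *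 ((4 + 48 * Ksp) * (8 * (9 * (L : ℝ) * (5 * (powScale (1 / 2) β * btLog β ^ 2)) + (powScale 1 β)))) ^ 2) * (4 : ℝ) ^ (flatDim L / 2 : ℝ) * Real.exp (-((1 / (4 * sliceConst L)) ^ 2 * (powScale 1 β * btLog β ^ 3) ^ 2 / (4 * (powScale 1 β) ^ 2))) * fpWeightBar L (powScale 1 β))))) *
            (Real.exp (-(882 * β * (9 * (L : ℝ) * (5 * (powScale (1 / 2) β * btLog β ^ 2)) + (powScale 1 β)) ^ 2 * ((min (1 / 40) (powScale (1 / 2) β * btLog β)) / 12) ^ 2)) -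
              Real.exp (49 * β * ((min (1 / 40) (powScale (1 / 2) β * btLog β)) / 12) ^ 2) * (Real.exp (-(β * (min ((8 * (9 * (L : ℝ) * (5 * (powScale (1 / 2) β * btLog β ^ 2)) + (powScale 1 β))) - 2 * (9 * (L : ℝ) * (5 * (powScale (1 / 2) β * btLog β ^ 2)) + (powScale 1 β))) ((9 / 10 * (min (1 / 40) (powScale (1 / 2) β * btLog β))) - 6 * (9 * (L : ℝ) * (5 * (powScale (1 / 2) β * btLog β ^ 2)) + (powScale 1 β)) ^ 2 * ((min (1 / 40) (powScale (1 / 2) β * btLog β)) / 12))) ^ 2 / 2)) * (π / (β / 2)) ^ ((Module.finrank ℝ (LinkSpace L) : ℝ) / 2)) /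
                stiffGaussTop L (β / 2) β))) ∧
      Real.exp (coreEta L β 0 (powScale (1 / 2) β * btLog β ^ 3) (9 * (L : ℝ) * (5 * (powScale (1 / 2) β * btLog β ^ 2)) + (powScale 1 β)) (min (1 / 40) (powScale (1 / 2) β * btLog β)) ((powScale 1 β) * Fintype.card (Site 3 L)) (powScale 1 β) + coreEps1 L β 0 (9 * (L : ℝ) * (5 * (powScale (1 / 2) β * btLog β ^ 2)) + (powScale 1 β)) (min (1 / 40) (powScale (1 / 2) β * btLog β)) + coreEps2 L β 0 (9 * (L : ℝ) * (5 * (powScale (1 / 2) β * btLog β ^ 2)) + (powScale 1 β)) (min (1 / 40) (powScale (1 / 2) β * btLog β)) (powScale 1 β)) *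
          (1 * (Real.exp (2 * β) ^ Fintype.card (Edge 3 L) * ((2 * π ^ 2)⁻¹) ^ Fintype.card (Edge 3 L) * Real.exp (2000 * Fintype.card (Plaquette 3 L) * (8 * (9 * (L : ℝ) * (5 * (powScale (1 / 2) β * btLog β ^ 2)) + (powScale 1 β))) ^ 3 * β) *
                Real.exp (8 * Fintype.card (Edge 3 L) * β * (8 * (9 * (L : ℝ) * (5 * (powScale (1 / 2) β * btLog β ^ 2)) + (powScale 1 β))) ^ 4) * (fpZ (powScale 1 β) * (1:ℝ) * (Real.exp (((96 * (β / 2) + (β)) * (B * (powScale 1 β * btLog β ^ 3) + MT * (powScale 1 β * btLog β ^ 3) ^ 2) * (2 * (Real.sqrt ((Fintype.card (Edge 3 L) : ℝ)) * (8 * (9 * (L : ℝ) * (5 * (powScale (1 / 2) β * btLog β ^ 2)) + (powScale 1 β))) + (7 * ((Fintype.card (Edge 3 L) : ℝ)) * (8 * (9 * (L : ℝ) * (5 * (powScale (1 / 2) β * btLog β ^ 2)) + (powScale 1 β))) + B * (9 * Ksp * (8 * (9 * (L : ℝ) * (5 * (powScale (1 / 2) β * btLog β ^ 2)) + (powScale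 1 β)))) + MT * (9 * Ksp * (8 * (9 * (L : ℝ) * (5 * (powScale (1 / 2) β * btLog β ^ 2)) + (powScale 1 β)))) ^ 2)) + (B * (powScale 1 β * btLog β ^ 3) + MT * (powScale 1 β * btLog β ^ 3) ^ 2))) + ((96 * (β / 2) + (β)) * ((CL * ((4 + 48 * Ksp) * (8 * (9 * (L : ℝ) * (5 * (powScale (1 / 2) β * btLog β ^ 2)) + (powScale 1 β)))) * (9 * Ksp * (8 * (9 * (L : ℝ) * (5 * (powScale (1 / 2) β * btLog β ^ 2)) + (powScale 1 β)))) + MT * (9 * Ksp * (8 * (9 * (L : ℝ) * (5 * (powScale (1 / 2) β * btLog β ^ 2)) + (powScale 1 β)))) ^ 2) * (2 * (Real.sqrt ((Fintype.card (Edge 3 L) : ℝ)) * (8 * (9 * (L : ℝ) * (5 * (powScale (1 / 2) β * btLog β ^ 2)) + (powScale 1 β))) + (7 * ((Fintype.card (Edge 3 L) : ℝ)) * (8 * (9 * (L : ℝ) * (5 * (powScale (1 / 2) β * btLog β ^ 2)) + (powScale 1 β))) + B * (9 * Ksp * (8 * (9 * (L : ℝ) * (5 * (powScale (1 / 2) β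 * btLog β ^ 2)) + (powScale 1 β)))) + MT * (9 * Ksp * (8 * (9 * (L : ℝ) * (5 * (powScale (1 / 2) β * btLog β ^ 2)) + (powScale 1 β)))) ^ 2)) + (CL * ((4 + 48 * Ksp) * (8 * (9 * (L : ℝ) * (5 * (powScale (1 / 2) β * btLog β ^ 2)) + (powScale 1 β)))) * (9 * Ksp * (8 * (9 * (L : ℝ) * (5 * (powScale (1 / 2) β * btLog β ^ 2)) + (powScale 1 β)))) + MT * (9 * Ksp * (8 * (9 * (L : ℝ) * (5 * (powScale (1 / 2) β * btLog β ^ 2)) + (powScale 1 β)))) ^ 2)) + 72 * ((Fintype.card (Edge 3 L) : ℝ)) * (8 * (9 * (L : ℝ) * (5 * (powScale (1 / 2) β * btLog β ^ 2)) + (powScale 1 β))) ^ 3))) * (fpWeightBar L (powScale 1 β) * (1 + Cp * (1 * powScale (1 / 4) β) ^ 2)) + ((1 + KD * ((4 + 48 * Ksp) * (8 * (9 * (L : ℝ) * (5 * (powScale (1 / 2) β * btLog β ^ 2)) + (powScale 1 β)))) ^ 2) * (4 : ℝ) ^ (flatDim L / 2 : ℝ) * Real.exp (-((1 / (4 * sliceConst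 L)) ^ 2 * (powScale 1 β * btLog β ^ 3) ^ 2 / (4 * (powScale 1 β) ^ 2))) * fpWeightBar L (powScale 1 β)) * Real.exp ((96 * (β / 2) + (β)) * (Real.sqrt ((Fintype.card (Edge 3 L) : ℝ)) * (8 * (9 * (L : ℝ) * (5 * (powScale (1 / 2) β * btLog β ^ 2)) + (powScale 1 β)))) ^ 2))) * Real.exp (882 * β * (9 * (L : ℝ) * (5 * (powScale (1 / 2) β * btLog β ^ 2)) + (powScale 1 β)) ^ 2 * ((min (1 / 40) (powScale (1 / 2) β * btLog β)) / 12) ^ 2) +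
              (1:ℝ) * (1:ℝ) * 1 * (Real.exp (2 * β) ^ Fintype.card (Edge 3 L) * Real.exp (-(β * (8 * (9 * (L : ℝ) * (5 * (powScale (1 / 2) β * btLog β ^ 2)) + (powScale 1 β))) ^ 2 / 4))) * Real.exp (49 * β * ((min (1 / 40) (powScale (1 / 2) β * btLog β)) / 12) ^ 2) / stiffGaussTop L (β / 2) β)) ≤ (1 + powScale (1 / 3) β) * (Real.exp (-(coreEta L β 0 (powScale (1 / 2) β * btLog β ^ 3) (9 * (L : ℝ) * (5 * (powScale (1 / 2) β * btLog β ^ 2)) + (powScale 1 β)) (min (1 / 40) (powScale (1 / 2) β * btLog β)) ((powScale 1 β) * Fintype.card (Site 3 L)) (powScale 1 β) + coreEps1 L β 0 (9 * (L : ℝ) * (5 * (powScale (1 / 2) β * btLog β ^ 2)) + (powScale 1 β)) (min (1 / 40) (powScale (1 / 2) β * btLog β)) + coreEps2 L β 0 (9 * (L : ℝ) * (5 * (powScale (1 / 2) β * btLog β ^ 2)) + (powScale 1 β)) (min (1 / 40) (powScale (1 / 2) β * btLog β)) (powScale 1 β))) *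
          (1 * (Real.exp (2 * β) ^ Fintype.card (Edge 3 L) * ((2 * π ^ 2)⁻¹ * ((1 + (8 * (9 * (L : ℝ) * (5 * (powScale (1 / 2) β * btLog β ^ 2)) + (powScale 1 β))) ^ 2)⁻¹) ^ 2) ^ Fintype.card (Edge 3 L) *
              Real.exp (-(2000 * Fintype.card (Plaquette 3 L) * (8 * (9 * (L : ℝ) * (5 * (powScale (1 / 2) β * btLog β ^ 2)) + (powScale 1 β))) ^ 3 * β)) * (fpZ (powScale 1 β) * ((1:ℝ) * Real.exp (-(((96 * (β / 2) + (β)) * (B * (powScale 1 β * btLog β ^ 3) + MT * (powScale 1 β * btLog β ^ 3) ^ 2) * (2 * ((((min (1 / 40) (powScale (1 / 2) β * btLog β)) / 12) + (9 / 10 * (min (1 / 40) (powScale (1 / 2) β * btLog β)))) + 14 * ((Fintype.card (Edge 3 L) : ℝ)) * (8 * (9 * (L : ℝ) * (5 * (powScale (1 / 2) β * btLog β ^ 2)) + (powScale 1 β))) ^ 2 + (CL * ((4 + 48 * Ksp) * (8 * (9 * (L : ℝ) * (5 * (powScale (1 / 2) β * btLog β ^ 2)) + (powScale 1 β)))) *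 (9 * Ksp * (8 * (9 * (L : ℝ) * (5 * (powScale (1 / 2) β * btLog β ^ 2)) + (powScale 1 β)))) + MT * (9 * Ksp * (8 * (9 * (L : ℝ) * (5 * (powScale (1 / 2) β * btLog β ^ 2)) + (powScale 1 β)))) ^ 2)) + (B * (powScale 1 β * btLog β ^ 3) + MT * (powScale 1 β * btLog β ^ 3) ^ 2))) + ((96 * (β / 2) + (β)) * ((CL * ((4 + 48 * Ksp) * (8 * (9 * (L : ℝ) * (5 * (powScale (1 / 2) β * btLog β ^ 2)) + (powScale 1 β)))) * (9 * Ksp * (8 * (9 * (L : ℝ) * (5 * (powScale (1 / 2) β * btLog β ^ 2)) + (powScale 1 β)))) + MT * (9 * Ksp * (8 * (9 * (L : ℝ) * (5 * (powScale (1 / 2) β * btLog β ^ 2)) + (powScale 1 β)))) ^ 2) * (2 * ((((min (1 / 40) (powScale (1 / 2) β * btLog β)) / 12) + (9 / 10 * (min (1 / 40) (powScale (1 / 2) β * btLog β)))) + 14 * ((Fintype.card (Edge 3 L) : ℝ)) * (8 * (9 * (L : ℝ) * (5 * (powScale (1 / 2) β * btLog β ^ 2)) + (powScale 1 β))) ^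 2 + (CL * ((4 + 48 * Ksp) * (8 * (9 * (L : ℝ) * (5 * (powScale (1 / 2) β * btLog β ^ 2)) + (powScale 1 β)))) * (9 * Ksp * (8 * (9 * (L : ℝ) * (5 * (powScale (1 / 2) β * btLog β ^ 2)) + (powScale 1 β)))) + MT * (9 * Ksp * (8 * (9 * (L : ℝ) * (5 * (powScale (1 / 2) β * btLog β ^ 2)) + (powScale 1 β)))) ^ 2)) + (CL * ((4 + 48 * Ksp) * (8 * (9 * (L : ℝ) * (5 * (powScale (1 / 2) β * btLog β ^ 2)) + (powScale 1 β)))) * (9 * Ksp * (8 * (9 * (L : ℝ) * (5 * (powScale (1 / 2) β * btLog β ^ 2)) + (powScale 1 β)))) + MT * (9 * Ksp * (8 * (9 * (L : ℝ) * (5 * (powScale (1 / 2) β * btLog β ^ 2)) + (powScale 1 β)))) ^ 2)) + 72 * ((Fintype.card (Edge 3 L) : ℝ)) * (8 * (9 * (L : ℝ) * (5 * (powScale (1 / 2) β * btLog β ^ 2)) + (powScale 1 β))) ^ 3)))) * ((fpWeightBar L (powScale 1 β) * (1 - Cp * (1 * powScale (1 / 4) β) ^ 2)) - ((1 + KD *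 ((4 + 48 * Ksp) * (8 * (9 * (L : ℝ) * (5 * (powScale (1 / 2) β * btLog β ^ 2)) + (powScale 1 β)))) ^ 2) * (4 : ℝ) ^ (flatDim L / 2 : ℝ) * Real.exp (-((1 / (4 * sliceConst L)) ^ 2 * (powScale 1 β * btLog β ^ 3) ^ 2 / (4 * (powScale 1 β) ^ 2))) * fpWeightBar L (powScale 1 β))))) *
            (Real.exp (-(882 * β * (9 * (L : ℝ) * (5 * (powScale (1 / 2) β * btLog β ^ 2)) + (powScale 1 β)) ^ 2 * ((min (1 / 40) (powScale (1 / 2) β * btLog β)) / 12) ^ 2)) -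
              Real.exp (49 * β * ((min (1 / 40) (powScale (1 / 2) β * btLog β)) / 12) ^ 2) * (Real.exp (-(β * (min ((8 * (9 * (L : ℝ) * (5 * (powScale (1 / 2) β * btLog β ^ 2)) + (powScale 1 β))) - 2 * (9 * (L : ℝ) * (5 * (powScale (1 / 2) β * btLog β ^ 2)) + (powScale 1 β))) ((9 / 10 * (min (1 / 40) (powScale (1 / 2) β * btLog β))) - 6 * (9 * (L : ℝ) * (5 * (powScale (1 / 2) β * btLog β ^ 2)) + (powScale 1 β)) ^ 2 * ((min (1 / 40) (powScale (1 / 2) β * btLog β)) / 12))) ^ 2 / 2)) * (π / (β / 2)) ^ ((Module.finrank ℝ (LinkSpace L) : ℝ) / 2)) /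
                stiffGaussTop L (β / 2) β)))) := by
  have hNpos : ∀ β : ℝ, 0 < (Real.exp (2 * β) ^ Fintype.card (Edge 3 L) * ((2 * π ^ 2)⁻¹) ^ Fintype.card (Edge 3 L) * fpZ (powScale 1 β) * fpWeightBar L (powScale 1 β)) := fun β => by
    have := fpZ_pos (powScale_pos 1 β); have := fpWeightBar_pos (L := L) (powScale_pos 1 β); positivity
  obtain ⟨wlo, tlo⟩ := weighted_lo_w3 (L := L) Ksp MT KD B CL Cp
  obtain ⟨whi, -⟩ := weighted_hi_w3 (L := L) Ksp MT KD B CL Cp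
  have hd := tendsto_sub_mul_weight wlo whi
  have hev1 : ∀ᶠ β : ℝ in atTop, (1 : ℝ) / 2 < (Real.exp (-(coreEta L β 0 (powScale (1 / 2) β * btLog β ^ 3) (9 * (L : ℝ) * (5 * (powScale (1 / 2) β * btLog β ^ 2)) + (powScale 1 β)) (min (1 / 40) (powScale (1 / 2) β * btLog β)) ((powScale 1 β) * Fintype.card (Site 3 L)) (powScale 1 β) + coreEps1 L β 0 (9 * (L : ℝ) * (5 * (powScale (1 / 2) β * btLog β ^ 2)) + (powScale 1 β)) (min (1 / 40) (powScale (1 / 2) β * btLog β)) + coreEps2 L β 0 (9 * (L : ℝ) * (5 * (powScale (1 / 2) β * btLog β ^ 2)) + (powScale 1 β)) (min (1 / 40) (powScale (1 / 2) β * btLog β)) (powScale 1 β))) *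
          (1 * (Real.exp (2 * β) ^ Fintype.card (Edge 3 L) * ((2 * π ^ 2)⁻¹ * ((1 + (8 * (9 * (L : ℝ) * (5 * (powScale (1 / 2) β * btLog β ^ 2)) + (powScale 1 β))) ^ 2)⁻¹) ^ 2) ^ Fintype.card (Edge 3 L) *
              Real.exp (-(2000 * Fintype.card (Plaquette 3 L) * (8 * (9 * (L : ℝ) * (5 * (powScale (1 / 2) β * btLog β ^ 2)) + (powScale 1 β))) ^ 3 * β)) * (fpZ (powScale 1 β) * ((1:ℝ) * Real.exp (-(((96 * (β / 2) + (β)) * (B * (powScale 1 β * btLog β ^ 3) + MT * (powScale 1 β * btLog β ^ 3) ^ 2) * (2 * ((((min (1 / 40) (powScale (1 / 2) β * btLog β)) / 12) + (9 / 10 * (min (1 / 40) (powScale (1 / 2) β * btLog β)))) + 14 * ((Fintype.card (Edge 3 L) : ℝ)) * (8 * (9 * (L : ℝ) * (5 * (powScale (1 / 2) β * btLog β ^ 2)) + (powScale 1 β))) ^ 2 + (CL * ((4 + 48 * Ksp) * (8 * (9 * (L : ℝ) * (5 * (powScale (1 / 2) β * btLog β ^ 2)) + (powScale 1 β)))) *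 (9 * Ksp * (8 * (9 * (L : ℝ) * (5 * (powScale (1 / 2) β * btLog β ^ 2)) + (powScale 1 β)))) + MT * (9 * Ksp * (8 * (9 * (L : ℝ) * (5 * (powScale (1 / 2) β * btLog β ^ 2)) + (powScale 1 β)))) ^ 2)) + (B * (powScale 1 β * btLog β ^ 3) + MT * (powScale 1 β * btLog β ^ 3) ^ 2))) + ((96 * (β / 2) + (β)) * ((CL * ((4 + 48 * Ksp) * (8 * (9 * (L : ℝ) * (5 * (powScale (1 / 2) β * btLog β ^ 2)) + (powScale 1 β)))) * (9 * Ksp * (8 * (9 * (L : ℝ) * (5 * (powScale (1 / 2) β * btLog β ^ 2)) + (powScale 1 β)))) + MT * (9 * Ksp * (8 * (9 * (L : ℝ) * (5 * (powScale (1 / 2) β * btLog β ^ 2)) + (powScale 1 β)))) ^ 2) * (2 * ((((min (1 / 40) (powScale (1 / 2) β * btLog β)) / 12) + (9 / 10 * (min (1 / 40) (powScale (1 / 2) β * btLog β)))) + 14 * ((Fintype.card (Edge 3 L) : ℝ)) * (8 * (9 * (L : ℝ) * (5 * (powScale (1 / 2) β * btLog β ^ 2)) + (powScale 1 β))) ^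 2 + (CL * ((4 + 48 * Ksp) * (8 * (9 * (L : ℝ) * (5 * (powScale (1 / 2) β * btLog β ^ 2)) + (powScale 1 β)))) * (9 * Ksp * (8 * (9 * (L : ℝ) * (5 * (powScale (1 / 2) β * btLog β ^ 2)) + (powScale 1 β)))) + MT * (9 * Ksp * (8 * (9 * (L : ℝ) * (5 * (powScale (1 / 2) β * btLog β ^ 2)) + (powScale 1 β)))) ^ 2)) + (CL * ((4 + 48 * Ksp) * (8 * (9 * (L : ℝ) * (5 * (powScale (1 / 2) β * btLog β ^ 2)) + (powScale 1 β)))) * (9 * Ksp * (8 * (9 * (L : ℝ) * (5 * (powScale (1 / 2) β * btLog β ^ 2)) + (powScale 1 β)))) + MT * (9 * Ksp * (8 * (9 * (L : ℝ) * (5 * (powScale (1 / 2) β * btLog β ^ 2)) + (powScale 1 β)))) ^ 2)) + 72 * ((Fintype.card (Edge 3 L) : ℝ)) * (8 * (9 * (L : ℝ) * (5 * (powScale (1 / 2) β * btLog β ^ 2)) + (powScale 1 β))) ^ 3)))) * ((fpWeightBar L (powScale 1 β) * (1 - Cp * (1 * powScale (1 / 4) β) ^ 2)) - ((1 + KD *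 ((4 + 48 * Ksp) * (8 * (9 * (L : ℝ) * (5 * (powScale (1 / 2) β * btLog β ^ 2)) + (powScale 1 β)))) ^ 2) * (4 : ℝ) ^ (flatDim L / 2 : ℝ) * Real.exp (-((1 / (4 * sliceConst L)) ^ 2 * (powScale 1 β * btLog β ^ 3) ^ 2 / (4 * (powScale 1 β) ^ 2))) * fpWeightBar L (powScale 1 β))))) *
            (Real.exp (-(882 * β * (9 * (L : ℝ) * (5 * (powScale (1 / 2) β * btLog β ^ 2)) + (powScale 1 β)) ^ 2 * ((min (1 / 40) (powScale (1 / 2) β * btLog β)) / 12) ^ 2)) -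
              Real.exp (49 * β * ((min (1 / 40) (powScale (1 / 2) β * btLog β)) / 12) ^ 2) * (Real.exp (-(β * (min ((8 * (9 * (L : ℝ) * (5 * (powScale (1 / 2) β * btLog β ^ 2)) + (powScale 1 β))) - 2 * (9 * (L : ℝ) * (5 * (powScale (1 / 2) β * btLog β ^ 2)) + (powScale 1 β))) ((9 / 10 * (min (1 / 40) (powScale (1 / 2) β * btLog β))) - 6 * (9 * (L : ℝ) * (5 * (powScale (1 / 2) β * btLog β ^ 2)) + (powScale 1 β)) ^ 2 * ((min (1 / 40) (powScale (1 / 2) β * btLog β)) / 12))) ^ 2 / 2)) * (π / (β / 2)) ^ ((Module.finrank ℝ (LinkSpace L) : ℝ) / 2)) /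
                stiffGaussTop L (β / 2) β)))) / (Real.exp (2 * β) ^ Fintype.card (Edge 3 L) * ((2 * π ^ 2)⁻¹) ^ Fintype.card (Edge 3 L) * fpZ (powScale 1 β) * fpWeightBar L (powScale 1 β)) := tlo.eventually (Ioi_mem_nhds (by norm_num))
  have hev2 : ∀ᶠ β : ℝ in atTop, ((Real.exp (coreEta L β 0 (powScale (1 / 2) β * btLog β ^ 3) (9 * (L : ℝ) * (5 * (powScale (1 / 2) β * btLog β ^ 2)) + (powScale 1 β)) (min (1 / 40) (powScale (1 / 2) β * btLog β)) ((powScale 1 β) * Fintype.card (Site 3 L)) (powScale 1 β) + coreEps1 L β 0 (9 * (L : ℝ) * (5 * (powScale (1 / 2) β * btLog β ^ 2)) + (powScale 1 β)) (min (1 / 40) (powScale (1 / 2) β * btLog β)) + coreEps2 L β 0 (9 * (L : ℝ) * (5 * (powScale (1 / 2) β * btLog β ^ 2)) + (powScale 1 β)) (min (1 / 40) (powScale (1 / 2) β * btLog β)) (powScale 1 β)) *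
          (1 * (Real.exp (2 * β) ^ Fintype.card (Edge 3 L) * ((2 * π ^ 2)⁻¹) ^ Fintype.card (Edge 3 L) * Real.exp (2000 * Fintype.card (Plaquette 3 L) * (8 * (9 * (L : ℝ) * (5 * (powScale (1 / 2) β * btLog β ^ 2)) + (powScale 1 β))) ^ 3 * β) *
                Real.exp (8 * Fintype.card (Edge 3 L) * β * (8 * (9 * (L : ℝ) * (5 * (powScale (1 / 2) β * btLog β ^ 2)) + (powScale 1 β))) ^ 4) * (fpZ (powScale 1 β) * (1:ℝ) * (Real.exp (((96 * (β / 2) + (β)) * (B * (powScale 1 β * btLog β ^ 3) + MT * (powScale 1 β * btLog β ^ 3) ^ 2) * (2 * (Real.sqrt ((Fintype.card (Edge 3 L) : ℝ)) * (8 * (9 * (L : ℝ) * (5 * (powScale (1 / 2) β * btLog β ^ 2)) + (powScale 1 β))) + (7 * ((Fintype.card (Edge 3 L) : ℝ)) * (8 * (9 * (L : ℝ) * (5 * (powScale (1 / 2) β * btLog β ^ 2)) + (powScale 1 β))) + B * (9 * Ksp * (8 * (9 * (L : ℝ) * (5 * (powScale (1 / 2) β * btLog β ^ 2)) + (powScale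 1 β)))) + MT * (9 * Ksp * (8 * (9 * (L : ℝ) * (5 * (powScale (1 / 2) β * btLog β ^ 2)) + (powScale 1 β)))) ^ 2)) + (B * (powScale 1 β * btLog β ^ 3) + MT * (powScale 1 β * btLog β ^ 3) ^ 2))) + ((96 * (β / 2) + (β)) * ((CL * ((4 + 48 * Ksp) * (8 * (9 * (L : ℝ) * (5 * (powScale (1 / 2) β * btLog β ^ 2)) + (powScale 1 β)))) * (9 * Ksp * (8 * (9 * (L : ℝ) * (5 * (powScale (1 / 2) β * btLog β ^ 2)) + (powScale 1 β)))) + MT * (9 * Ksp * (8 * (9 * (L : ℝ) * (5 * (powScale (1 / 2) β * btLog β ^ 2)) + (powScale 1 β)))) ^ 2) * (2 * (Real.sqrt ((Fintype.card (Edge 3 L) : ℝ)) * (8 * (9 * (L : ℝ) * (5 * (powScale (1 / 2) β * btLog β ^ 2)) + (powScale 1 β))) + (7 * ((Fintype.card (Edge 3 L) : ℝ)) * (8 * (9 * (L : ℝ) * (5 * (powScale (1 / 2) β * btLog β ^ 2)) + (powScale 1 β))) + B * (9 * Ksp * (8 * (9 * (L : ℝ) * (5 * (powScale (1 / 2) β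 * btLog β ^ 2)) + (powScale 1 β)))) + MT * (9 * Ksp * (8 * (9 * (L : ℝ) * (5 * (powScale (1 / 2) β * btLog β ^ 2)) + (powScale 1 β)))) ^ 2)) + (CL * ((4 + 48 * Ksp) * (8 * (9 * (L : ℝ) * (5 * (powScale (1 / 2) β * btLog β ^ 2)) + (powScale 1 β)))) * (9 * Ksp * (8 * (9 * (L : ℝ) * (5 * (powScale (1 / 2) β * btLog β ^ 2)) + (powScale 1 β)))) + MT * (9 * Ksp * (8 * (9 * (L : ℝ) * (5 * (powScale (1 / 2) β * btLog β ^ 2)) + (powScale 1 β)))) ^ 2)) + 72 * ((Fintype.card (Edge 3 L) : ℝ)) * (8 * (9 * (L : ℝ) * (5 * (powScale (1 / 2) β * btLog β ^ 2)) + (powScale 1 β))) ^ 3))) * (fpWeightBar L (powScale 1 β) * (1 + Cp * (1 * powScale (1 / 4) β) ^ 2)) + ((1 + KD * ((4 + 48 * Ksp) * (8 * (9 * (L : ℝ) * (5 * (powScale (1 / 2) β * btLog β ^ 2)) + (powScale 1 β)))) ^ 2) * (4 : ℝ) ^ (flatDim L / 2 : ℝ) * Real.exp (-((1 / (4 * sliceConst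 L)) ^ 2 * (powScale 1 β * btLog β ^ 3) ^ 2 / (4 * (powScale 1 β) ^ 2))) * fpWeightBar L (powScale 1 β)) * Real.exp ((96 * (β / 2) + (β)) * (Real.sqrt ((Fintype.card (Edge 3 L) : ℝ)) * (8 * (9 * (L : ℝ) * (5 * (powScale (1 / 2) β * btLog β ^ 2)) + (powScale 1 β)))) ^ 2))) * Real.exp (882 * β * (9 * (L : ℝ) * (5 * (powScale (1 / 2) β * btLog β ^ 2)) + (powScale 1 β)) ^ 2 * ((min (1 / 40) (powScale (1 / 2) β * btLog β)) / 12) ^ 2) +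
              (1:ℝ) * (1:ℝ) * 1 * (Real.exp (2 * β) ^ Fintype.card (Edge 3 L) * Real.exp (-(β * (8 * (9 * (L : ℝ) * (5 * (powScale (1 / 2) β * btLog β ^ 2)) + (powScale 1 β))) ^ 2 / 4))) * Real.exp (49 * β * ((min (1 / 40) (powScale (1 / 2) β * btLog β)) / 12) ^ 2) / stiffGaussTop L (β / 2) β))) / (Real.exp (2 * β) ^ Fintype.card (Edge 3 L) * ((2 * π ^ 2)⁻¹) ^ Fintype.card (Edge 3 L) * fpZ (powScale 1 β) * fpWeightBar L (powScale 1 β)) - (Real.exp (-(coreEta L β 0 (powScale (1 / 2) β * btLog β ^ 3) (9 * (L : ℝ) * (5 * (powScale (1 / 2) β * btLog β ^ 2)) + (powScale 1 β)) (min (1 / 40) (powScale (1 / 2) β * btLog β)) ((powScale 1 β) * Fintype.card (Site 3 L)) (powScale 1 β) + coreEps1 L β 0 (9 * (L : ℝ) * (5 * (powScale (1 / 2) β * btLog β ^ 2)) + (powScale 1 β)) (min (1 / 40) (powScale (1 / 2) β * btLog β)) + coreEps2 L β 0 (9 * (L : ℝ) * (5 * (powScale (1 / 2) β * btLog β ^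 2)) + (powScale 1 β)) (min (1 / 40) (powScale (1 / 2) β * btLog β)) (powScale 1 β))) *
          (1 * (Real.exp (2 * β) ^ Fintype.card (Edge 3 L) * ((2 * π ^ 2)⁻¹ * ((1 + (8 * (9 * (L : ℝ) * (5 * (powScale (1 / 2) β * btLog β ^ 2)) + (powScale 1 β))) ^ 2)⁻¹) ^ 2) ^ Fintype.card (Edge 3 L) *
              Real.exp (-(2000 * Fintype.card (Plaquette 3 L) * (8 * (9 * (L : ℝ) * (5 * (powScale (1 / 2) β * btLog β ^ 2)) + (powScale 1 β))) ^ 3 * β)) * (fpZ (powScale 1 β) * ((1:ℝ) * Real.exp (-(((96 * (β / 2) + (β)) * (B * (powScale 1 β * btLog β ^ 3) + MT * (powScale 1 β * btLog β ^ 3) ^ 2) * (2 * ((((min (1 / 40) (powScale (1 / 2) β * btLog β)) / 12) + (9 / 10 * (min (1 / 40) (powScale (1 / 2) β * btLog β)))) + 14 * ((Fintype.card (Edge 3 L) : ℝ)) * (8 * (9 * (L : ℝ) * (5 * (powScale (1 / 2) β * btLog β ^ 2)) + (powScale 1 β))) ^ 2 + (CL * ((4 + 48 * Ksp) * (8 *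 (9 * (L : ℝ) * (5 * (powScale (1 / 2) β * btLog β ^ 2)) + (powScale 1 β)))) * (9 * Ksp * (8 * (9 * (L : ℝ) * (5 * (powScale (1 / 2) β * btLog β ^ 2)) + (powScale 1 β)))) + MT * (9 * Ksp * (8 * (9 * (L : ℝ) * (5 * (powScale (1 / 2) β * btLog β ^ 2)) + (powScale 1 β)))) ^ 2)) + (B * (powScale 1 β * btLog β ^ 3) + MT * (powScale 1 β * btLog β ^ 3) ^ 2))) + ((96 * (β / 2) + (β)) * ((CL * ((4 + 48 * Ksp) * (8 * (9 * (L : ℝ) * (5 * (powScale (1 / 2) β * btLog β ^ 2)) + (powScale 1 β)))) * (9 * Ksp * (8 * (9 * (L : ℝ) * (5 * (powScale (1 / 2) β * btLog β ^ 2)) + (powScale 1 β)))) + MT * (9 * Ksp * (8 * (9 * (L : ℝ) * (5 * (powScale (1 / 2) β * btLog β ^ 2)) + (powScale 1 β)))) ^ 2) * (2 * ((((min (1 / 40) (powScale (1 / 2) β * btLog β)) / 12) + (9 / 10 * (min (1 / 40) (powScale (1 / 2) β * btLog β)))) + 14 * ((Fintype.card (Edge 3 L) : ℝ)) * (8 *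 (9 * (L : ℝ) * (5 * (powScale (1 / 2) β * btLog β ^ 2)) + (powScale 1 β))) ^ 2 + (CL * ((4 + 48 * Ksp) * (8 * (9 * (L : ℝ) * (5 * (powScale (1 / 2) β * btLog β ^ 2)) + (powScale 1 β)))) * (9 * Ksp * (8 * (9 * (L : ℝ) * (5 * (powScale (1 / 2) β * btLog β ^ 2)) + (powScale 1 β)))) + MT * (9 * Ksp * (8 * (9 * (L : ℝ) * (5 * (powScale (1 / 2) β * btLog β ^ 2)) + (powScale 1 β)))) ^ 2)) + (CL * ((4 + 48 * Ksp) * (8 * (9 * (L : ℝ) * (5 * (powScale (1 / 2) β * btLog β ^ 2)) + (powScale 1 β)))) * (9 * Ksp * (8 * (9 * (L : ℝ) * (5 * (powScale (1 / 2) β * btLog β ^ 2)) + (powScale 1 β)))) + MT * (9 * Ksp * (8 * (9 * (L : ℝ) * (5 * (powScale (1 / 2) β * btLog β ^ 2)) + (powScale 1 β)))) ^ 2)) + 72 * ((Fintype.card (Edge 3 L) : ℝ)) * (8 * (9 * (L : ℝ) * (5 * (powScale (1 / 2) β * btLog β ^ 2)) + (powScale 1 β))) ^ 3)))) * ((fpWeightBar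 L (powScale 1 β) * (1 - Cp * (1 * powScale (1 / 4) β) ^ 2)) - ((1 + KD * ((4 + 48 * Ksp) * (8 * (9 * (L : ℝ) * (5 * (powScale (1 / 2) β * btLog β ^ 2)) + (powScale 1 β)))) ^ 2) * (4 : ℝ) ^ (flatDim L / 2 : ℝ) * Real.exp (-((1 / (4 * sliceConst L)) ^ 2 * (powScale 1 β * btLog β ^ 3) ^ 2 / (4 * (powScale 1 β) ^ 2))) * fpWeightBar L (powScale 1 β))))) *
            (Real.exp (-(882 * β * (9 * (L : ℝ) * (5 * (powScale (1 / 2) β * btLog β ^ 2)) + (powScale 1 β)) ^ 2 * ((min (1 / 40) (powScale (1 / 2) β * btLog β)) / 12) ^ 2)) -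
              Real.exp (49 * β * ((min (1 / 40) (powScale (1 / 2) β * btLog β)) / 12) ^ 2) * (Real.exp (-(β * (min ((8 * (9 * (L : ℝ) * (5 * (powScale (1 / 2) β * btLog β ^ 2)) + (powScale 1 β))) - 2 * (9 * (L : ℝ) * (5 * (powScale (1 / 2) β * btLog β ^ 2)) + (powScale 1 β))) ((9 / 10 * (min (1 / 40) (powScale (1 / 2) β * btLog β))) - 6 * (9 * (L : ℝ) * (5 * (powScale (1 / 2) β * btLog β ^ 2)) + (powScale 1 β)) ^ 2 * ((min (1 / 40) (powScale (1 / 2) β * btLog β)) / 12))) ^ 2 / 2)) * (π / (β / 2)) ^ ((Module.finrank ℝ (LinkSpace L) : ℝ) / 2)) /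
                stiffGaussTop L (β / 2) β)))) / (Real.exp (2 * β) ^ Fintype.card (Edge 3 L) * ((2 * π ^ 2)⁻¹) ^ Fintype.card (Edge 3 L) * fpZ (powScale 1 β) * fpWeightBar L (powScale 1 β))) * powScale (-(1 / 3)) β < 1 / 2 := hd.eventually (Iio_mem_nhds (by norm_num))
  filter_upwards [hev1, hev2] with β h1 h2
  exact ratio_rate_of_weighted (hNpos β) h1 h2 (powScale_fifth_mul_weight_w3 β) (powScale_pos _ _)

end Summit.QuantumFields.YangMills.Theorems.FemtoTransferGap.TwoLattice.ConstTube
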